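import Literature.Analysis.Quadrature.TrapezoidalRuleRealLine
import Literature.Analysis.ValidatedNumerics.PeriodicTrapezoidCert
import HarnessLib

/-!
# Kernel-checked exponentially convergent trapezoidal rule on the real line: enclosures of
# `∫_ℝ e^{-c x²} v(x) dx` for integrands analytic in a strip, by one `decide`

Trunk T-ANA (Analysis/ValidatedNumerics); namespace `Literature.Analysis.ValidatedNumerics.RealLineTrapezoid`.
Sequel of `Literature/Analysis/Quadrature/TrapezoidalRuleRealLine.lean` (the ANALYSIS, proved there once and for
all: if `w : ℂ → ℂ` is holomorphic in the strip `|Im z| < a`, `∫ |w(x + iy)| dx ≤ M` for `|y| < a`, `w → 0`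
uniformly in the strip as `|Re z| → ∞`, and `w(x) = O(|x|^{-b})` on `ℝ` for some `b > 1` (the Poisson-summation
hypothesis), then `‖h Σ_{k ∈ ℤ} w(kh) − ∫_ℝ w‖ ≤ 2M/(e^{2πa/h} − 1)` — `norm_tsum_sub_integral_le_of_strip`,
Trefethen–Weideman's Theorem 5.1; NUMBERING of the published SIAM Review version throughout: its Sect. 5,
Thm. 5.1, (5.4), Sect. 6 are Sect. 6, Thm. 6.1, (6.4), Sect. 7 of the Oxford report NA-13-15 of the same paper),
of `PeriodicTrapezoidCert.lean` (the periodic sibling, whose rational/integer kernels `expUb`, `invI`, `sqrtI` are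
reused) and of `MultiPrecisionInterval.lean` (outward-rounded scaled-integer interval arithmetic `MI` / `MC` at a
scale `S`, with the kernels `MI.exp`, `MI.pi`, `MC.expI` and their soundness).
THE PROBLEM (Trefethen–Weideman, Sects. 5–6): for an integrand analytic in a strip around `ℝ` and decaying
along it, the trapezoidal rule `I_h = h Σ_{k ∈ ℤ} w(kh)` converges exponentially as `h → 0` — at the rate
`e^{−π²/h²}` for `e^{−x²}` and `e^{−2π/h}` for `e^{−x²}/(1 + x²)`, `e^{−x²}/√(1 + x²)` (op. cit. Sect. 6,
Table 6.1) — and the bound of Theorem 5.1 is EXPLICIT once `a` and `M` are known (for `e^{−x²}`, `M = e^{a²}√π`).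
A CERTIFICATE needs (i) a certified `M` for the chosen strip, including the guarantee that the continuation of
the integrand IS holomorphic there (no zero of a denominator, no branch point of a square root), (ii) a certified
bound for the truncation of the infinite sum to the `2n + 1` samples `|k| ≤ n` (the truncated rule `I_h^{[n]}`,
(5.4); "the truncation error can be estimated as the magnitude of the integrand at the truncation points",
Sect. 6), and (iii) a rigorous evaluation of those samples.  The anchor had no kernel client; this module supplies
(i)–(iii) for the GAUSSIAN-DECAY class `w(x) = e^{−c x²} v(x)`, `c > 0` rational, `v` in a code list, in four parts:

* Part A — SYNTAX AND SEMANTICS: `RExpr` (rational constants, the shifted squares `(x − u)²`, the oscillations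
  `cos qx`, `sin qx` with `u, q` rational, and `+ − × exp cos sin ⁻¹ √`), its complex semantics `evalC`
  (principal `√`) and real semantics `evalR`.
* Part B — A STRIP MAJORANT CALCULUS WITH UNBOUNDED SUBEXPRESSIONS: the strip is `|Im z| < a` with `a > 0`
  RATIONAL; `bnd a e : SBX = (ub : Option ℚ, lb : ℚ, relo rehi : Option ℚ)` propagates an optional upper bound
  of `|w|`, a lower bound of `|w|` and optional bounds of `Re w` for the value `w` of every subexpression over the
  strip (`none` = no bound: the shifted square has `ub = none` but `Re (z − u)² ≥ −a²`, which is exactly what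
  makes `1/(p + (x − u)²)`, `1/√(p + x²)`, `e^{−(x − u)²}`, … admissible whenever `a² < p`); every bound is
  rational (`e^x ≤ (68/25)^⌈x⌉`, `|cos qz|, |sin qz| ≤ cosh(|q|a) ≤ (expUb(|q|a) + 1)/2`, `|cos w| ≤ cosh |w|`,
  `|w⁻¹| ≤ 1/lb`, `|√w| ≤ (1 + |w|)/2`, `|√w| ≥ min(max(lb, relo), 1)`), and the side conditions `ok a e` (every
  reciprocal has a certified `lb > 0`, every radicand a certified `relo > 0`, decided over `ℚ`) make the
  continuation holomorphic: `sbx_evalC` (ONE induction: `ok a e → |Im z| < a → SBXnd (evalC e z) (bnd a e) ∧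
  DifferentiableAt ℂ (evalC e) z`), `differentiableOn_evalC`, `norm_evalC_le`, `evalC_ofReal`.
* Part C — THE ERROR THEOREM: with `U` the certified strip bound of `v`, the hypotheses of the anchor are
  discharged for `w(z) = e^{−c z²} v(z)` with `M = U e^{c a²} √(π/c)` (`|e^{−c z²}| = e^{−c (x² − y²)}`,
  `integral_gaussian`) and `b = 2` — `norm_wC_le`, `differentiableOn_wC`, `integrable_wC_line`,
  `integral_norm_wC_le`, `wC_vanishing`, `wC_isBigO` — giving `abs_tsum_sub_integral_le`; the sum over `ℤ` is
  split as `Σ_{k ≥ 1} + w(0) + Σ_{k ≤ −1}` (`HasSum.of_add_one_of_neg_add_one`) and truncated with the geometric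
  Gaussian tails `|w(±(n + 1 + m)h)| ≤ U e^{−c (n+1)² h²} (e^{−2c h² (n+1)})^m`, `abs_truncSum_sub_tsum_le`;
  together, `abs_truncSum_sub_integral_le`:
  `|h T_n − ∫_ℝ w| ≤ 2U e^{c a²} √(π/c)/(e^{2πa/h} − 1) + 2hU e^{−c (n+1)² h²}/(1 − e^{−2c h² (n+1)})`
  where `T_n = w(0) + Σ_{m<n} (w((m+1)h) + w(−(m+1)h))` (`truncSum`).
* Part D — THE KERNEL: the interval evaluator `evalMIR` of `v` at a rational node (`MI.exp`, `MC.expI` for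
  `exp cos sin`, the sign-tested reciprocal `invI` and the self-validating square root `sqrtI` of the periodic
  sibling), `mem_evalMIR` (the fundamental theorem of interval arithmetic for the code list); the sample `wMI`
  and the folded truncated sum `rtSum` (`mem_rtSum`); the two error terms as intervals, `discErrMI` (`π` by
  `MI.pi`, `√(π/c)` by `sqrtI`) and `truncErrMI` (computed as `2hU/(e^{c (n+1)² h²}(1 − e^{−2c h² (n+1)}))`, the
  tiny Gaussian being a large DIVISOR so that it keeps full relative precision at a fixed absolute scale);
  the certificate data `rtData` (`h T_n` and the error radius as intervals at scale `S`) and the Boolean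
  CERTIFICATE `rtCheck e c a h n S K k lo hi` (integer arithmetic only); MAIN THEOREM `integral_mem_of_rtCheck`:
  `rtCheck … = true → lo ≤ ∫ x, e^{−c x²} · evalR e x ≤ hi`, hypothesis-free but for the Boolean, which the
  kernel decides.

Parameters (all chosen by the untrusted proposer; any values that pass are sound): `a` just below the distance
from `ℝ` to the nearest singularity of `v` (too large an `a` simply fails `ok`), and for entire `v` near the
minimiser of `c a² + log U(a) − 2πa/h` (for `v = 1` the choice `a = π/(ch)` recovers the rate `e^{−π²/(c h²)}` of
Table 6.1); `n` with `c (n+1)² h² ≈ 2πa/h − c a²` (balance of truncation and discretization); the scale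
`S ≈ 10^{digits+12}`; `K` Taylor / Machin terms (`K ≥ 0.22 log₂ S` for full working precision, fewer if
the target width allows); `k` argument halvings of `MI.exp` with `max(2πa/h, c a², c (n+1)² h²) ≲ 2^k`.
Kernel cost is linear in `n`: `0.3–0.5 s` per node at `S = 2²⁵⁶`, `K = 50–60` on the farm; beyond about `150`
nodes the certificate needs `set_option maxHeartbeats 0 in` (or a few million: the kernel's check of
`decide +kernel` is heartbeat-limited and otherwise reports that the `Decidable` instance "did not reduce to
`isTrue` or `isFalse`" although `#eval rtCheck … = true` — that message replaces WHATEVER exception the kernel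
check raised; a bare `mkAuxLemma` of the same `decide` proof term surfaces the real one, and rejects a false
certificate with `(kernel) application type mismatch`).  A certificate taking interval square roots at
several hundred nodes (integer Newton from a cold start, about `270` iterations on `520`-bit integers per
endpoint) is best checked FIRST in its file: on the farm the `K₀` certificate below passes alone (`146 s`) and
fails reproducibly, with that same generic message and unlimited heartbeats, as the third certificate of one
file.  The node sum is accumulated by binary splitting (`blockSum`), so that the kernel meets an expression
tree of logarithmic depth rather than a chain of `n` pending additions.

Worked end to end (scratch kept OUT of the tree, `Certquad.ScratchRealLine`, three files on top of this module,
`146 + 104 + 246 s`; `1217` nodes in all, `S = 2²⁵⁶`), each by ONE `decide +kernel` of `rtCheck` followed by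
`simp only [evalR]; push_cast; simpa` to display the integrand: `∫_ℝ e^{−x²} dx` (`= √π`; `a = 25/2`,
`h = 1/4`, `n = 50`, `101` nodes) to width `1.9·10⁻⁶⁸` — the certified discretization radius `9.35·10⁻⁶⁹`
against the true error `I_h − I ≈ 2√π e^{−π²/h²} ≈ 9.3·10⁻⁶⁹`: Theorem 5.1 is sharp here and the kernel loses
nothing; `∫_ℝ e^{−x²} cos 2x dx` (`= √π/e`; `|cos 2z| ≤ cosh 2a`; `a = 13`, `h = 2/9`, `n = 62`, `125` nodes) to
`8.3·10⁻⁷³`; and three integrands with singularities at distance `1` from the axis, rate `e^{−2πa/h}`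
(`a = 19/20`, `h = 1/20`, `n = 216`, `433` nodes, `K = 50`, `k = 7`): `∫_ℝ e^{−x²}/√(1 + x²) dx`
(`= e^{1/2} K₀(1/2)`, the second row of Table 6.1), `∫_ℝ e^{−x²}/(1 + x²) dx` (`= π e erfc 1`) and the Voigt
profile `∫_ℝ e^{−x²}/((x − 1)² + 1) dx` (`= π Re w(1 + i)`, `w` the Faddeeva function), each to `2.9·10⁻⁵⁰`.
The closed forms are NOT used or proved; reference values computed independently (series for `erf`, the
trapezoidal rule for `K₀(x) = ∫₀^∞ e^{−x cosh t} dt`, 90 digits) lie inside every bracket.  The same code list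
covers Gaussian moments of rational and trigonometric functions, Voigt / plasma-dispersion values `Re w(x + iy)`
at rational points, and `e^{p²/4c}`-normalised Fourier transforms `∫ e^{−c x²} cos px · v(x) dx`.

Honest framing.  These are shared numerical engines serving client cells; rigour lives in the verifiers (the
soundness theorems below, whose only hypothesis is a Boolean certificate decided by the kernel); every published
number belongs to a client cell's ledger, not to the engines group.  ANCHOR / nearest in-tree relatives:
`Quadrature.TrapezoidalRuleRealLine` (USED: `norm_tsum_sub_integral_le_of_strip` — all the complex analysis is
there; this is its first kernel client), `PeriodicTrapezoidCert` (USED: `expUb`, `invI`, `sqrtI`, `mem_invI`,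
`mem_sqrtI`; the periodic rule, whose all-rational strip data `SB` cannot express an unbounded subexpression —
hence the `Option`-valued `SBX` here), `MultiPrecisionInterval` (USED: `MI.add/neg/sub/mul/divPos/ofInt/ofFrac/
exp/pi`, `MC.expI` and their `mem_*`), `Quadrature.TanhSinhTransformation` (the double-exponential variant,
analysis only — not bridged: the strip image under `tanh((π/2) sinh ·)` is lens-shaped and a constant-majorant
calculus does not bound the transformed integrand), `TaylorModelIntegralCert*` (compact intervals, algebraic
order).  Nearest prior art in print: the Petras–Johansson rigorous integrator of Arb (adaptive Gauss–Legendre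
with magnitude bounds from ball evaluation on ellipses; infinite intervals by user truncation; not
kernel-checked) and CoqInterval's verified quadrature (formally verified, algebraic order, improper integrals via
explicit integrable bounds); here the strip bound `M`, the holomorphy side conditions and the Gaussian tail are a
closed-form rational calculus, so that the only interval evaluations are at the `2n + 1` real nodes and of four
transcendental constants.  Deliberately NOT here: integrands with merely exponential decay (`e^{−x tanh x}`-type
weights, the first row of Table 6.1, and `K`-Bessel-type integrands `e^{−cosh x}` — they need `x`-dependent
majorants), shifted Gaussian weights `e^{−c (x − μ)²}` with `μ ≠ 0` (substitute first), unbounded factors `v`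
(polynomial moments), the half-line, Hilbert-transform, sinc and double-exponential variants and the
optimal-parameter theory of Sects. 5–6, adaptivity, complex-valued integrals,
and any floating-point arithmetic (all certificate data are exact rationals and scaled integers).
Problem-independent; no facts, no axioms; all certificate data computable over `ℚ` and `ℤ`.

References: [cite: TrefethenWeideman2014, Thm. 5.1]; [cite: TrefethenWeideman2014, Sect. 5 (5.4)];
[cite: TrefethenWeideman2014, Sect. 6]; [cite: DavisRabinowitz1984, Sect. 3.4 (3.4.1a)];
[cite: Moore1979, Thm. 3.1]; [cite: Moore1979, Sect. 3.3]; [cite: Moore1979, Sect. 4.4 (4.11)];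
[cite: Moore1979, Sect. 4.4 (4.12)]; [cite: Johansson2018, Sect. 2];
[cite: MahboubiMelquiondSibutpinote2016, Sect. 4.1].

AI-produced formalisation (H21 engines group, seat eng-quad-3 gen 61, 2026-08-23); no facts, no axioms, no `sorry`.
-/

open scoped Real

namespace Literature.Analysis.ValidatedNumerics

namespace RealLineTrapezoid

open Literature.Analysis.ValidatedNumerics.NumericsMP
open PeriodicTrapezoid (expUb sqrtI invI mem_sqrtI mem_invI)

/-! ### Part A. The bounded analytic factor: syntax, complex and real semantics -/

/-- The language of the bounded factor `v` of the integrand `w(x) = e^{-c x²} v(x)`: rational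
constants, the shifted squares `(x - u)²`, the oscillations `cos qx`, `sin qx` (`u, q` rational), and
`+ − × exp cos sin`, reciprocal and square root — a code list of unary standard functions and binary
arithmetic operations in the sense of interval analysis. [cite: Moore1979, Sect. 4.4 (4.11)] -/
inductive RExpr : Type
  | const (c : ℚ)
  | sq (u : ℚ)
  | cosX (q : ℚ)
  | sinX (q : ℚ)
  | add (e f : RExpr)
  | sub (e f : RExpr)
  | neg (e : RExpr)
  | mul (e f : RExpr)
  | exp (e : RExpr)
  | cos (e : RExpr)
  | sin (e : RExpr)
  | inv (e : RExpr)
  | sqrt (e : RExpr)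

/-- Complex semantics (the analytic continuation of the factor into the strip): `√w` is the
principal branch `w ^ (1/2)`. [cite: TrefethenWeideman2014, Thm. 5.1] -/
noncomputable def evalC : RExpr → ℂ → ℂ
  | .const c => fun _ => (c : ℂ)
  | .sq u => fun z => (z - (u : ℂ)) ^ 2
  | .cosX q => fun z => Complex.cos ((q : ℂ) * z)
  | .sinX q => fun z => Complex.sin ((q : ℂ) * z)
  | .add e f => fun z => evalC e z + evalC f z
  | .sub e f => fun z => evalC e z - evalC f z
  | .neg e => fun z => -evalC e z
  | .mul e f => fun z => evalC e z * evalC f z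
  | .exp e => fun z => Complex.exp (evalC e z)
  | .cos e => fun z => Complex.cos (evalC e z)
  | .sin e => fun z => Complex.sin (evalC e z)
  | .inv e => fun z => (evalC e z)⁻¹
  | .sqrt e => fun z => evalC e z ^ (((1 : ℝ) / 2 : ℝ) : ℂ)

/-- Real semantics: the factor `x ↦ v(x)` on the real axis. [cite: TrefethenWeideman2014, Thm. 5.1] -/
noncomputable def evalR : RExpr → ℝ → ℝ
  | .const c, _ => (c : ℝ)
  | .sq u, x => (x - u) ^ 2
  | .cosX q, x => Real.cos (q * x)
  | .sinX q, x => Real.sin (q * x)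
  | .add e f, x => evalR e x + evalR f x
  | .sub e f, x => evalR e x - evalR f x
  | .neg e, x => -evalR e x
  | .mul e f, x => evalR e x * evalR f x
  | .exp e, x => Real.exp (evalR e x)
  | .cos e, x => Real.cos (evalR e x)
  | .sin e, x => Real.sin (evalR e x)
  | .inv e, x => (evalR e x)⁻¹
  | .sqrt e, x => Real.sqrt (evalR e x)

/-! ### Part B. A strip majorant calculus with unbounded subexpressions

Certified data `lb ≤ |v(z)| ≤ ub`, `relo ≤ Re v(z) ≤ rehi` on the strip `|Im z| < a` (`a > 0`
rational), where each of `ub`, `relo`, `rehi` may be ABSENT (`none`: no bound claimed — the shifted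
square `(z - u)²` is unbounded on the strip but has the certified lower bound `Re (z - u)² ≥ -a²`,
which is what makes `1/((x - u)² + p)` and `1/√((x - u)² + p)` admissible for `p > a²`). -/

/-- Certified strip data: an optional upper bound `ub` and a lower bound `lb` of `|v(z)|`, and
optional bounds `relo ≤ Re v(z) ≤ rehi`, all rational (`none` = no bound claimed).
[cite: Moore1979, Sect. 3.3] -/
structure SBX where
  /-- upper bound of `‖v z‖` on the strip, if any -/
  ub : Option ℚ
  /-- lower bound of `‖v z‖` on the strip -/
  lb : ℚ
  /-- lower bound of `Re (v z)` on the strip, if any -/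
  relo : Option ℚ
  /-- upper bound of `Re (v z)` on the strip, if any -/
  rehi : Option ℚ
  deriving Repr

/-- `x ≤ U` when the optional upper bound is present. [cite: Moore1979, Sect. 3.3] -/
def UBnd (x : ℝ) : Option ℚ → Prop
  | none => True
  | some U => x ≤ (U : ℝ)

/-- `L ≤ x` when the optional lower bound is present. [cite: Moore1979, Sect. 3.3] -/
def LBnd (x : ℝ) : Option ℚ → Prop
  | none => True
  | some L => (L : ℝ) ≤ x

/-- The soundness predicate of strip data at one point. [cite: Moore1979, Thm. 3.1] -/
structure SBXnd (v : ℂ) (B : SBX) : Prop where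
  norm_le : UBnd ‖v‖ B.ub
  le_norm : (B.lb : ℝ) ≤ ‖v‖
  le_re : LBnd v.re B.relo
  re_le : UBnd v.re B.rehi

/-- Sum of optional bounds (present iff both are). [cite: Moore1979, Sect. 3.3] -/
def oadd : Option ℚ → Option ℚ → Option ℚ
  | some x, some y => some (x + y)
  | _, _ => none

/-- Negation of an optional bound. [cite: Moore1979, Sect. 3.3] -/
def oneg : Option ℚ → Option ℚ
  | some x => some (-x)
  | none => none

/-- Product of optional (nonnegative) bounds. [cite: Moore1979, Sect. 3.3] -/
def omul : Option ℚ → Option ℚ → Option ℚ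
  | some x, some y => some (x * y)
  | _, _ => none

namespace SBX

/-- First lower-bound candidate of a sum: `lb₁ - ub₂`. [cite: Moore1979, Sect. 3.3] -/
def addL1 (A B : SBX) : ℚ := match B.ub with | some U => A.lb - U | none => 0
/-- Second lower-bound candidate of a sum: `lb₂ - ub₁`. [cite: Moore1979, Sect. 3.3] -/
def addL2 (A B : SBX) : ℚ := match A.ub with | some U => B.lb - U | none => 0
/-- Third lower-bound candidate of a sum: `relo₁ + relo₂`. [cite: Moore1979, Sect. 3.3] -/
def addL3 (A B : SBX) : ℚ :=
  match A.relo, B.relo with | some x, some y => x + y | _, _ => 0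
/-- Fourth lower-bound candidate of a sum: `-(rehi₁ + rehi₂)`. [cite: Moore1979, Sect. 3.3] -/
def addL4 (A B : SBX) : ℚ :=
  match A.rehi, B.rehi with | some x, some y => -(x + y) | _, _ => 0

/-- Strip data of a sum. [cite: Moore1979, Sect. 3.3] -/
def addB (A B : SBX) : SBX :=
  ⟨oadd A.ub B.ub, max (max (addL1 A B) (addL2 A B)) (max (addL3 A B) (addL4 A B)),
    oadd A.relo B.relo, oadd A.rehi B.rehi⟩

/-- Strip data of a negation. [cite: Moore1979, Sect. 3.3] -/
def negB (A : SBX) : SBX := ⟨A.ub, A.lb, oneg A.rehi, oneg A.relo⟩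

/-- Strip data of a difference. [cite: Moore1979, Sect. 3.3] -/
def subB (A B : SBX) : SBX := addB A (negB B)

/-- Strip data of a product. [cite: Moore1979, Sect. 3.3] -/
def mulB (A B : SBX) : SBX :=
  ⟨omul A.ub B.ub, max A.lb 0 * max B.lb 0, oneg (omul A.ub B.ub), omul A.ub B.ub⟩

/-- The optional bound `expUb rehi` of `|e^v| = e^{Re v}`. [cite: Moore1979, Sect. 3.3] -/
def expU (A : SBX) : Option ℚ := match A.rehi with | some R => some (expUb R) | none => none

/-- The lower bound `1/expUb (-relo)` of `|e^v|` (or `0`). [cite: Moore1979, Sect. 3.3] -/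
def expL (A : SBX) : ℚ := match A.relo with | some L => (expUb (-L))⁻¹ | none => 0

/-- Strip data of `exp v`. [cite: Moore1979, Sect. 3.3] -/
def expB (A : SBX) : SBX := ⟨expU A, expL A, oneg (expU A), expU A⟩

/-- The optional bound `(expUb ub + 1)/2 ≥ cosh ub` of `|cos v|`, `|sin v|`.
[cite: Moore1979, Sect. 3.3] -/
def trigU (A : SBX) : Option ℚ :=
  match A.ub with | some U => some ((expUb U + 1) / 2) | none => none

/-- Strip data of `cos v` and `sin v`: `|cos v|, |sin v| ≤ cosh |Im v| ≤ cosh |v|`.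
[cite: Moore1979, Sect. 3.3] -/
def trigB (A : SBX) : SBX := ⟨trigU A, 0, oneg (trigU A), trigU A⟩

/-- The lower bound `1/ub` of `|1/v|` (or `0`). [cite: Moore1979, Sect. 3.3] -/
def invL (A : SBX) : ℚ := match A.ub with | some U => U⁻¹ | none => 0

/-- Strip data of `1/v` (meaningful when `A.lb > 0`). [cite: Moore1979, Sect. 3.3] -/
def invB (A : SBX) : SBX := ⟨some A.lb⁻¹, invL A, some (-A.lb⁻¹), some A.lb⁻¹⟩

/-- The optional bound `(1 + ub)/2 ≥ √ub` of `|√v|`. [cite: Moore1979, Sect. 3.3] -/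
def sqrtU (A : SBX) : Option ℚ :=
  match A.ub with | some U => some ((1 + U) / 2) | none => none

/-- Strip data of the principal `√v` (meaningful when `relo > 0`): `√u ≤ (1 + u)/2`,
`√u ≥ min (u, 1)`, `Re √v ≥ 0`. [cite: Moore1979, Sect. 3.3] -/
def sqrtB (A : SBX) : SBX := ⟨sqrtU A, min (max A.lb (A.relo.getD 0)) 1, some 0, sqrtU A⟩

end SBX

/-- `(expUb (|q|·a) + 1)/2 ≥ cosh (|q| a)`, the bound of `|cos qz|`, `|sin qz|` on `|Im z| < a`.
[cite: TrefethenWeideman2014, Thm. 5.1] -/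
def coshUb (q a : ℚ) : ℚ := (expUb (|q| * a) + 1) / 2

/-- The strip data of an expression for the strip `|Im z| < a` (`a > 0` rational), by structural
recursion; the shifted square is unbounded with `Re (z - u)² ≥ -a²`. [cite: Moore1979, Sect. 4.4 (4.11)] -/
def bnd (a : ℚ) : RExpr → SBX
  | .const c => ⟨some |c|, |c|, some c, some c⟩
  | .sq _ => ⟨none, 0, some (-(a ^ 2)), none⟩
  | .cosX q => ⟨some (coshUb q a), 0, some (-coshUb q a), some (coshUb q a)⟩
  | .sinX q => ⟨some (coshUb q a), 0, some (-coshUb q a), some (coshUb q a)⟩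
  | .add e f => (bnd a e).addB (bnd a f)
  | .sub e f => (bnd a e).subB (bnd a f)
  | .neg e => (bnd a e).negB
  | .mul e f => (bnd a e).mulB (bnd a f)
  | .exp e => (bnd a e).expB
  | .cos e => (bnd a e).trigB
  | .sin e => (bnd a e).trigB
  | .inv e => (bnd a e).invB
  | .sqrt e => (bnd a e).sqrtB

/-- A certified positive optional lower bound. [cite: Moore1979, Sect. 4.4 (4.12)] -/
def posOpt : Option ℚ → Bool
  | some L => decide (0 < L)
  | none => false

/-- The side conditions under which the strip data are sound and the factor is analytic in the
strip: every reciprocal has a certified positive lower bound of `|v|`, every square root a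
certified positive lower bound of `Re v`. [cite: Moore1979, Sect. 4.4 (4.12)] -/
def ok (a : ℚ) : RExpr → Bool
  | .const _ => true
  | .sq _ => true
  | .cosX _ => true
  | .sinX _ => true
  | .add e f => ok a e && ok a f
  | .sub e f => ok a e && ok a f
  | .neg e => ok a e
  | .mul e f => ok a e && ok a f
  | .exp e => ok a e
  | .cos e => ok a e
  | .sin e => ok a e
  | .inv e => ok a e && decide (0 < (bnd a e).lb)
  | .sqrt e => ok a e && posOpt (bnd a e).relo

/-! #### Soundness of the combinators -/

/-- `|cos w| ≤ cosh (Im w)`. [folklore] -/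
private theorem norm_cos_le_cosh_im (w : ℂ) : ‖Complex.cos w‖ ≤ Real.cosh w.im := by
  have h1 : ‖Complex.exp (w * Complex.I)‖ = Real.exp (-w.im) := by
    rw [Complex.norm_exp]
    congr 1
    simp [Complex.mul_re]
  have h2 : ‖Complex.exp (-w * Complex.I)‖ = Real.exp w.im := by
    rw [Complex.norm_exp]
    congr 1
    simp [Complex.mul_re]
  have hcos : Complex.cos w = (Complex.exp (w * Complex.I) + Complex.exp (-w * Complex.I)) / 2 := rfl
  rw [hcos, norm_div, Complex.norm_two, Real.cosh_eq]
  gcongr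
  calc ‖Complex.exp (w * Complex.I) + Complex.exp (-w * Complex.I)‖
      ≤ ‖Complex.exp (w * Complex.I)‖ + ‖Complex.exp (-w * Complex.I)‖ := norm_add_le _ _
    _ = Real.exp w.im + Real.exp (-w.im) := by rw [h1, h2, add_comm]

/-- `|sin w| ≤ cosh (Im w)`. [folklore] -/
private theorem norm_sin_le_cosh_im (w : ℂ) : ‖Complex.sin w‖ ≤ Real.cosh w.im := by
  have h1 : ‖Complex.exp (w * Complex.I)‖ = Real.exp (-w.im) := by
    rw [Complex.norm_exp]
    congr 1
    simp [Complex.mul_re]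
  have h2 : ‖Complex.exp (-w * Complex.I)‖ = Real.exp w.im := by
    rw [Complex.norm_exp]
    congr 1
    simp [Complex.mul_re]
  have hsin : Complex.sin w =
      (Complex.exp (-w * Complex.I) - Complex.exp (w * Complex.I)) * Complex.I / 2 := rfl
  rw [hsin, norm_div, norm_mul, Complex.norm_I, mul_one, Complex.norm_two, Real.cosh_eq]
  gcongr
  calc ‖Complex.exp (-w * Complex.I) - Complex.exp (w * Complex.I)‖
      ≤ ‖Complex.exp (-w * Complex.I)‖ + ‖Complex.exp (w * Complex.I)‖ := norm_sub_le _ _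
    _ = Real.exp w.im + Real.exp (-w.im) := by rw [h1, h2]

/-- `e^x ≤ expUb q` for `x ≤ q`. [folklore] -/
private theorem exp_le_expUb {x : ℝ} {q : ℚ} (h : x ≤ q) : Real.exp x ≤ ((expUb q : ℚ) : ℝ) := by
  unfold expUb
  push_cast
  have hq : (q : ℝ) ≤ ((⌈q⌉₊ : ℕ) : ℝ) := by exact_mod_cast Nat.le_ceil q
  have he : Real.exp 1 ≤ (68 / 25 : ℝ) := by
    have := Real.exp_one_lt_d9
    norm_num at this ⊢
    linarith
  calc Real.exp x ≤ Real.exp ((⌈q⌉₊ : ℕ) : ℝ) := Real.exp_le_exp.mpr (h.trans hq)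
    _ = Real.exp 1 ^ ⌈q⌉₊ := by rw [← Real.exp_nat_mul, mul_one]
    _ ≤ (68 / 25 : ℝ) ^ ⌈q⌉₊ := pow_le_pow_left₀ (Real.exp_pos 1).le he _

/-- `cosh t ≤ (expUb q + 1)/2` for `|t| ≤ q`. [folklore] -/
private theorem cosh_le_of_abs_le {t : ℝ} {q : ℚ} (h : |t| ≤ q) :
    Real.cosh t ≤ (((expUb q + 1) / 2 : ℚ) : ℝ) := by
  have h1 : Real.cosh t ≤ Real.cosh (q : ℝ) := Real.cosh_le_cosh.mpr (h.trans (le_abs_self _))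
  have h2 : Real.exp (q : ℝ) ≤ ((expUb q : ℚ) : ℝ) := exp_le_expUb le_rfl
  have h3 : Real.exp (-(q : ℝ)) ≤ 1 := by
    rw [Real.exp_le_one_iff]
    linarith [abs_nonneg t]
  have h4 : Real.cosh (q : ℝ) = (Real.exp (q : ℝ) + Real.exp (-(q : ℝ))) / 2 := Real.cosh_eq _
  push_cast
  linarith

/-- Strip data from norm information alone. [folklore] -/
private theorem sbx_of_norm {v : ℂ} {oU : Option ℚ} {L : ℚ} (hU : UBnd ‖v‖ oU) (hL : (L : ℝ) ≤ ‖v‖) :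
    SBXnd v ⟨oU, L, oneg oU, oU⟩ := by
  cases oU with
  | none => exact ⟨trivial, hL, trivial, trivial⟩
  | some U =>
    simp only [UBnd] at hU
    have h := Complex.abs_re_le_norm v
    rw [abs_le] at h
    refine ⟨hU, hL, ?_, ?_⟩
    · simp only [oneg, LBnd]
      push_cast
      linarith [h.1]
    · simp only [UBnd]
      linarith [h.2]

/-- Soundness of the strip data of a constant. [cite: Moore1979, Thm. 3.1] -/
theorem SBXnd.const (c : ℚ) : SBXnd (c : ℂ) ⟨some |c|, |c|, some c, some c⟩ where
  norm_le := by simp only [UBnd]; rw [Complex.norm_ratCast]; push_cast; exact le_rfl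
  le_norm := by rw [Complex.norm_ratCast]; push_cast; exact le_rfl
  le_re := by simp [LBnd]
  re_le := by simp [UBnd]

/-- Soundness of `addB`. [cite: Moore1979, Thm. 3.1] -/
theorem SBXnd.add {z w : ℂ} {A B : SBX} (hz : SBXnd z A) (hw : SBXnd w B) :
    SBXnd (z + w) (A.addB B) where
  norm_le := by
    simp only [SBX.addB]
    have h1 := hz.norm_le
    have h2 := hw.norm_le
    cases hA : A.ub with
    | none => simp [oadd, UBnd]
    | some U =>
      cases hB : B.ub with
      | none => simp [oadd, UBnd]
      | some V =>
        rw [hA] at h1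
        rw [hB] at h2
        simp only [oadd, UBnd] at h1 h2 ⊢
        push_cast
        exact (norm_add_le z w).trans (add_le_add h1 h2)
  le_norm := by
    simp only [SBX.addB]
    have n1 : ‖z‖ ≤ ‖z + w‖ + ‖w‖ := norm_le_add_norm_add z w
    have n2 : ‖w‖ ≤ ‖z + w‖ + ‖z‖ := norm_le_add_norm_add' z w
    have n4 := Complex.abs_re_le_norm (z + w)
    rw [abs_le, Complex.add_re] at n4
    have c1 : (SBX.addL1 A B : ℝ) ≤ ‖z + w‖ := by
      unfold SBX.addL1
      have h2 := hw.norm_le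
      cases hB : B.ub with
      | none => push_cast; exact norm_nonneg _
      | some V =>
        rw [hB] at h2
        simp only [UBnd] at h2
        push_cast
        linarith [hz.le_norm]
    have c2 : (SBX.addL2 A B : ℝ) ≤ ‖z + w‖ := by
      unfold SBX.addL2
      have h1 := hz.norm_le
      cases hA : A.ub with
      | none => push_cast; exact norm_nonneg _
      | some U =>
        rw [hA] at h1
        simp only [UBnd] at h1
        push_cast
        linarith [hw.le_norm]
    have c3 : (SBX.addL3 A B : ℝ) ≤ ‖z + w‖ := by
      unfold SBX.addL3
      have h1 := hz.le_re
      have h2 := hw.le_re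
      cases hA : A.relo with
      | none => push_cast; exact norm_nonneg _
      | some x =>
        cases hB : B.relo with
        | none => push_cast; exact norm_nonneg _
        | some y =>
          rw [hA] at h1
          rw [hB] at h2
          simp only [LBnd] at h1 h2
          push_cast
          linarith [n4.2]
    have c4 : (SBX.addL4 A B : ℝ) ≤ ‖z + w‖ := by
      unfold SBX.addL4
      have h1 := hz.re_le
      have h2 := hw.re_le
      cases hA : A.rehi with
      | none => push_cast; exact norm_nonneg _
      | some x =>
        cases hB : B.rehi with
        | none => push_cast; exact norm_nonneg _
        | some y =>
          rw [hA] at h1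
          rw [hB] at h2
          simp only [UBnd] at h1 h2
          push_cast
          linarith [n4.1]
    push_cast
    exact max_le (max_le c1 c2) (max_le c3 c4)
  le_re := by
    simp only [SBX.addB]
    have h1 := hz.le_re
    have h2 := hw.le_re
    cases hA : A.relo with
    | none => simp [oadd, LBnd]
    | some x =>
      cases hB : B.relo with
      | none => simp [oadd, LBnd]
      | some y =>
        rw [hA] at h1
        rw [hB] at h2
        simp only [oadd, LBnd, Complex.add_re] at h1 h2 ⊢
        push_cast
        linarith
  re_le := by
    simp only [SBX.addB]
    have h1 := hz.re_le
    have h2 := hw.re_le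
    cases hA : A.rehi with
    | none => simp [oadd, UBnd]
    | some x =>
      cases hB : B.rehi with
      | none => simp [oadd, UBnd]
      | some y =>
        rw [hA] at h1
        rw [hB] at h2
        simp only [oadd, UBnd, Complex.add_re] at h1 h2 ⊢
        push_cast
        linarith

/-- Soundness of `negB`. [cite: Moore1979, Thm. 3.1] -/
theorem SBXnd.neg {z : ℂ} {A : SBX} (hz : SBXnd z A) : SBXnd (-z) A.negB where
  norm_le := by simp only [SBX.negB, norm_neg]; exact hz.norm_le
  le_norm := by simp only [SBX.negB, norm_neg]; exact hz.le_norm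
  le_re := by
    simp only [SBX.negB]
    have h := hz.re_le
    cases hA : A.rehi with
    | none => simp [oneg, LBnd]
    | some x =>
      rw [hA] at h
      simp only [oneg, LBnd, UBnd, Complex.neg_re] at h ⊢
      push_cast
      linarith
  re_le := by
    simp only [SBX.negB]
    have h := hz.le_re
    cases hA : A.relo with
    | none => simp [oneg, UBnd]
    | some x =>
      rw [hA] at h
      simp only [oneg, LBnd, UBnd, Complex.neg_re] at h ⊢
      push_cast
      linarith

/-- Soundness of `subB`. [cite: Moore1979, Thm. 3.1] -/
theorem SBXnd.sub {z w : ℂ} {A B : SBX} (hz : SBXnd z A) (hw : SBXnd w B) :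
    SBXnd (z - w) (A.subB B) := by
  rw [sub_eq_add_neg]
  exact hz.add hw.neg

/-- Soundness of `mulB`. [cite: Moore1979, Thm. 3.1] -/
theorem SBXnd.mul {z w : ℂ} {A B : SBX} (hz : SBXnd z A) (hw : SBXnd w B) :
    SBXnd (z * w) (A.mulB B) := by
  have hU : UBnd ‖z * w‖ (omul A.ub B.ub) := by
    have h1 := hz.norm_le
    have h2 := hw.norm_le
    cases hA : A.ub with
    | none => simp [omul, UBnd]
    | some U =>
      cases hB : B.ub with
      | none => simp [omul, UBnd]
      | some V =>
        rw [hA] at h1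
        rw [hB] at h2
        simp only [omul, UBnd] at h1 h2 ⊢
        rw [norm_mul]
        push_cast
        exact mul_le_mul h1 h2 (norm_nonneg w) ((norm_nonneg z).trans h1)
  have hL : ((max A.lb 0 * max B.lb 0 : ℚ) : ℝ) ≤ ‖z * w‖ := by
    rw [norm_mul]
    push_cast
    exact mul_le_mul (max_le hz.le_norm (norm_nonneg z)) (max_le hw.le_norm (norm_nonneg w))
      (le_max_right _ _) (norm_nonneg z)
  exact sbx_of_norm hU hL

/-- Soundness of `expB`. [cite: Moore1979, Thm. 3.1] -/
theorem SBXnd.exp {z : ℂ} {A : SBX} (hz : SBXnd z A) : SBXnd (Complex.exp z) A.expB := by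
  have hU : UBnd ‖Complex.exp z‖ (SBX.expU A) := by
    unfold SBX.expU
    have h := hz.re_le
    cases hA : A.rehi with
    | none => simp [UBnd]
    | some R =>
      rw [hA] at h
      simp only [UBnd] at h ⊢
      rw [Complex.norm_exp]
      exact exp_le_expUb h
  have hL : ((SBX.expL A : ℚ) : ℝ) ≤ ‖Complex.exp z‖ := by
    unfold SBX.expL
    have h := hz.le_re
    cases hA : A.relo with
    | none => push_cast; exact norm_nonneg _
    | some L =>
      rw [hA] at h
      simp only [LBnd] at h
      rw [Complex.norm_exp, Rat.cast_inv]
      have h1 : Real.exp (-z.re) ≤ ((expUb (-L) : ℚ) : ℝ) :=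
        exp_le_expUb (by push_cast; linarith)
      have h2 := inv_anti₀ (Real.exp_pos _) h1
      rwa [Real.exp_neg, inv_inv] at h2
  exact sbx_of_norm hU hL

/-- `cosh (Im z) ≤ trigU` from `‖z‖ ≤ ub`. [folklore] -/
private theorem cosh_im_le_trigU {z : ℂ} {A : SBX} (hz : SBXnd z A) {u : ℝ} (hu : u ≤ Real.cosh z.im) :
    UBnd u (SBX.trigU A) := by
  unfold SBX.trigU
  have h := hz.norm_le
  cases hA : A.ub with
  | none => simp [UBnd]
  | some U =>
    rw [hA] at h
    simp only [UBnd] at h ⊢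
    exact hu.trans (cosh_le_of_abs_le ((Complex.abs_im_le_norm z).trans h))

/-- Soundness of `trigB` for `cos`. [cite: Moore1979, Thm. 3.1] -/
theorem SBXnd.cos {z : ℂ} {A : SBX} (hz : SBXnd z A) : SBXnd (Complex.cos z) A.trigB :=
  sbx_of_norm (cosh_im_le_trigU hz (norm_cos_le_cosh_im z)) (by push_cast; exact norm_nonneg _)

/-- Soundness of `trigB` for `sin`. [cite: Moore1979, Thm. 3.1] -/
theorem SBXnd.sin {z : ℂ} {A : SBX} (hz : SBXnd z A) : SBXnd (Complex.sin z) A.trigB :=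
  sbx_of_norm (cosh_im_le_trigU hz (norm_sin_le_cosh_im z)) (by push_cast; exact norm_nonneg _)

/-- Soundness of `invB` under `0 < lb`. [cite: Moore1979, Thm. 3.1] -/
theorem SBXnd.inv {z : ℂ} {A : SBX} (hz : SBXnd z A) (hlb : 0 < A.lb) : SBXnd z⁻¹ A.invB := by
  have hlb' : (0 : ℝ) < A.lb := by exact_mod_cast hlb
  have hzpos : 0 < ‖z‖ := hlb'.trans_le hz.le_norm
  have hU : ‖z⁻¹‖ ≤ ((A.lb⁻¹ : ℚ) : ℝ) := by
    rw [norm_inv, Rat.cast_inv]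
    exact inv_anti₀ hlb' hz.le_norm
  have hL : ((SBX.invL A : ℚ) : ℝ) ≤ ‖z⁻¹‖ := by
    unfold SBX.invL
    have h := hz.norm_le
    cases hA : A.ub with
    | none => push_cast; exact norm_nonneg _
    | some U =>
      rw [hA] at h
      simp only [UBnd] at h
      rw [norm_inv, Rat.cast_inv]
      exact inv_anti₀ hzpos h
  have := sbx_of_norm (oU := some A.lb⁻¹) hU hL
  simpa [SBX.invB, oneg] using this

/-- A point with certified positive `lb` is nonzero. [folklore] -/
private theorem ne_zero_of_lb {z : ℂ} {A : SBX} (hz : SBXnd z A) (hlb : 0 < A.lb) : z ≠ 0 := by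
  have hlb' : (0 : ℝ) < A.lb := by exact_mod_cast hlb
  exact norm_pos_iff.mp (hlb'.trans_le hz.le_norm)

/-- `posOpt o = true` means `o = some L` with `0 < L`. [folklore] -/
private theorem posOpt_iff {o : Option ℚ} : posOpt o = true ↔ ∃ L, o = some L ∧ 0 < L := by
  cases o with
  | none => simp [posOpt]
  | some L => simp [posOpt]

/-- A point with certified positive `relo` has positive real part. [folklore] -/
private theorem re_pos_of_posOpt {z : ℂ} {A : SBX} (hz : SBXnd z A) (h : posOpt A.relo = true) :
    0 < z.re := by
  obtain ⟨L, hL, hL0⟩ := posOpt_iff.mp h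
  have h1 := hz.le_re
  rw [hL] at h1
  simp only [LBnd] at h1
  have : (0 : ℝ) < L := by exact_mod_cast hL0
  linarith

/-- Soundness of `sqrtB` under a certified positive `relo`. [cite: Moore1979, Thm. 3.1] -/
theorem SBXnd.sqrt {z : ℂ} {A : SBX} (hz : SBXnd z A) (h : posOpt A.relo = true) :
    SBXnd (z ^ (((1 : ℝ) / 2 : ℝ) : ℂ)) A.sqrtB := by
  obtain ⟨L, hL, hL0⟩ := posOpt_iff.mp h
  have hre : 0 < z.re := re_pos_of_posOpt hz h
  have hnorm : ‖z ^ (((1 : ℝ) / 2 : ℝ) : ℂ)‖ = Real.sqrt ‖z‖ := by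
    rw [Complex.norm_cpow_real, Real.sqrt_eq_rpow]
  have hU : UBnd ‖z ^ (((1 : ℝ) / 2 : ℝ) : ℂ)‖ (SBX.sqrtU A) := by
    unfold SBX.sqrtU
    have h1 := hz.norm_le
    cases hA : A.ub with
    | none => simp [UBnd]
    | some U =>
      rw [hA] at h1
      simp only [UBnd] at h1 ⊢
      have hU0 : (0 : ℝ) ≤ U := (norm_nonneg z).trans h1
      rw [hnorm]
      push_cast
      calc Real.sqrt ‖z‖ ≤ Real.sqrt (U : ℝ) := Real.sqrt_le_sqrt h1
        _ ≤ (1 + (U : ℝ)) / 2 := by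
          rw [Real.sqrt_le_left (by linarith)]
          nlinarith [sq_nonneg ((U : ℝ) - 1)]
  have hLB : ((min (max A.lb (A.relo.getD 0)) 1 : ℚ) : ℝ) ≤ ‖z ^ (((1 : ℝ) / 2 : ℝ) : ℂ)‖ := by
    rw [hnorm, hL, Option.getD_some]
    push_cast
    have h1 := hz.le_re
    rw [hL] at h1
    simp only [LBnd] at h1
    have hmax : max (A.lb : ℝ) (L : ℝ) ≤ ‖z‖ :=
      max_le hz.le_norm (h1.trans (Complex.re_le_norm z))
    by_cases h1 : 1 ≤ ‖z‖
    · calc min (max (A.lb : ℝ) (L : ℝ)) 1 ≤ 1 := min_le_right _ _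
        _ ≤ Real.sqrt ‖z‖ := by rw [Real.le_sqrt (by norm_num) (by linarith)]; linarith
    · have h1 := not_le.mp h1
      calc min (max (A.lb : ℝ) (L : ℝ)) 1 ≤ ‖z‖ := (min_le_left _ _).trans hmax
        _ ≤ Real.sqrt ‖z‖ := by
          rw [Real.le_sqrt (norm_nonneg z) (norm_nonneg z)]
          nlinarith [norm_nonneg z]
  refine ⟨by simpa [SBX.sqrtB] using hU, by simpa [SBX.sqrtB] using hLB, ?_, ?_⟩
  · simp only [SBX.sqrtB, LBnd, Rat.cast_zero]
    rw [Complex.cpow_ofReal_re]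
    refine mul_nonneg (Real.rpow_nonneg (norm_nonneg z) _) (Real.cos_nonneg_of_mem_Icc ⟨?_, ?_⟩)
    · have := Complex.neg_pi_lt_arg z
      linarith
    · have := Complex.arg_le_pi z
      linarith
  · simp only [SBX.sqrtB]
    unfold SBX.sqrtU at hU ⊢
    cases hA : A.ub with
    | none => simp [UBnd]
    | some U =>
      rw [hA] at hU
      simp only [UBnd] at hU ⊢
      exact (Complex.re_le_norm _).trans hU

/-- Soundness of the oscillation bound: `|cos qz| ≤ cosh (|q| a) ≤ coshUb q a` on `|Im z| < a`.
[cite: TrefethenWeideman2014, Thm. 5.1] -/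
theorem SBXnd.cosX {a : ℚ} (q : ℚ) {z : ℂ} (hz : |z.im| < a) :
    SBXnd (Complex.cos ((q : ℂ) * z)) ⟨some (coshUb q a), 0, some (-coshUb q a), some (coshUb q a)⟩ := by
  have him : |((q : ℂ) * z).im| ≤ ((|q| * a : ℚ) : ℝ) := by
    simp only [Complex.mul_im, Complex.ratCast_re, Complex.ratCast_im, zero_mul, add_zero]
    push_cast
    rw [abs_mul]
    exact mul_le_mul_of_nonneg_left hz.le (abs_nonneg _)
  have hU : UBnd ‖Complex.cos ((q : ℂ) * z)‖ (some (coshUb q a)) := by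
    simp only [UBnd, coshUb]
    exact (norm_cos_le_cosh_im _).trans (cosh_le_of_abs_le him)
  have := sbx_of_norm hU (L := 0) (by push_cast; exact norm_nonneg _)
  simpa [oneg] using this

/-- `|sin qz| ≤ coshUb q a` on `|Im z| < a`. [cite: TrefethenWeideman2014, Thm. 5.1] -/
theorem SBXnd.sinX {a : ℚ} (q : ℚ) {z : ℂ} (hz : |z.im| < a) :
    SBXnd (Complex.sin ((q : ℂ) * z)) ⟨some (coshUb q a), 0, some (-coshUb q a), some (coshUb q a)⟩ := by
  have him : |((q : ℂ) * z).im| ≤ ((|q| * a : ℚ) : ℝ) := by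
    simp only [Complex.mul_im, Complex.ratCast_re, Complex.ratCast_im, zero_mul, add_zero]
    push_cast
    rw [abs_mul]
    exact mul_le_mul_of_nonneg_left hz.le (abs_nonneg _)
  have hU : UBnd ‖Complex.sin ((q : ℂ) * z)‖ (some (coshUb q a)) := by
    simp only [UBnd, coshUb]
    exact (norm_sin_le_cosh_im _).trans (cosh_le_of_abs_le him)
  have := sbx_of_norm hU (L := 0) (by push_cast; exact norm_nonneg _)
  simpa [oneg] using this

/-- Soundness of the shifted-square data: `Re (z - u)² = (x - u)² - y² ≥ -a²` on `|Im z| < a`.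
[cite: TrefethenWeideman2014, Thm. 5.1] -/
theorem SBXnd.sq {a : ℚ} (u : ℚ) {z : ℂ} (hz : |z.im| < a) :
    SBXnd ((z - (u : ℂ)) ^ 2) ⟨none, 0, some (-(a ^ 2)), none⟩ := by
  refine ⟨trivial, by push_cast; exact norm_nonneg _, ?_, trivial⟩
  simp only [LBnd]
  have hre : ((z - (u : ℂ)) ^ 2).re = (z.re - u) ^ 2 - z.im ^ 2 := by
    rw [pow_two, Complex.mul_re, Complex.sub_re, Complex.sub_im, Complex.ratCast_re, Complex.ratCast_im]
    ring
  rw [hre]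
  push_cast
  have h1 : z.im ^ 2 < (a : ℝ) ^ 2 := by
    have ha : (0 : ℝ) ≤ a := (abs_nonneg _).trans hz.le
    calc z.im ^ 2 = |z.im| ^ 2 := (sq_abs _).symm
      _ < (a : ℝ) ^ 2 := by
        exact pow_lt_pow_left₀ hz (abs_nonneg _) two_ne_zero
  nlinarith [sq_nonneg (z.re - u)]

/-! #### The soundness theorem of the strip calculus -/

/-- **Soundness of the strip majorant calculus.**  If `ok a e`, then at every point of the strip
`|Im z| < a` the factor is complex-differentiable and its value obeys the strip data `bnd a e`.
[cite: Moore1979, Thm. 3.1] -/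
theorem sbx_evalC {a : ℚ} :
    ∀ (e : RExpr), ok a e = true → ∀ z : ℂ, |z.im| < a →
      SBXnd (evalC e z) (bnd a e) ∧ DifferentiableAt ℂ (evalC e) z := by
  intro e
  induction e with
  | const c =>
    intro _ z _
    simp only [evalC, bnd]
    exact ⟨SBXnd.const c, differentiableAt_const _⟩
  | sq u =>
    intro _ z hz
    simp only [evalC, bnd]
    exact ⟨SBXnd.sq u hz, (differentiableAt_id.sub_const _).pow 2⟩
  | cosX q =>
    intro _ z hz
    simp only [evalC, bnd]
    exact ⟨SBXnd.cosX q hz, ((differentiableAt_id.const_mul (q : ℂ)).ccos)⟩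
  | sinX q =>
    intro _ z hz
    simp only [evalC, bnd]
    exact ⟨SBXnd.sinX q hz, ((differentiableAt_id.const_mul (q : ℂ)).csin)⟩
  | add e f ihe ihf =>
    intro hok z hz
    simp only [ok, Bool.and_eq_true] at hok
    have h1 := ihe hok.1 z hz
    have h2 := ihf hok.2 z hz
    simp only [evalC, bnd]
    exact ⟨h1.1.add h2.1, h1.2.add h2.2⟩
  | sub e f ihe ihf =>
    intro hok z hz
    simp only [ok, Bool.and_eq_true] at hok
    have h1 := ihe hok.1 z hz
    have h2 := ihf hok.2 z hz
    simp only [evalC, bnd]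
    exact ⟨h1.1.sub h2.1, h1.2.sub h2.2⟩
  | neg e ih =>
    intro hok z hz
    simp only [ok] at hok
    have h1 := ih hok z hz
    simp only [evalC, bnd]
    exact ⟨h1.1.neg, h1.2.neg⟩
  | mul e f ihe ihf =>
    intro hok z hz
    simp only [ok, Bool.and_eq_true] at hok
    have h1 := ihe hok.1 z hz
    have h2 := ihf hok.2 z hz
    simp only [evalC, bnd]
    exact ⟨h1.1.mul h2.1, h1.2.mul h2.2⟩
  | exp e ih =>
    intro hok z hz
    simp only [ok] at hok
    have h1 := ih hok z hz
    simp only [evalC, bnd]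
    exact ⟨h1.1.exp, h1.2.cexp⟩
  | cos e ih =>
    intro hok z hz
    simp only [ok] at hok
    have h1 := ih hok z hz
    simp only [evalC, bnd]
    exact ⟨h1.1.cos, h1.2.ccos⟩
  | sin e ih =>
    intro hok z hz
    simp only [ok] at hok
    have h1 := ih hok z hz
    simp only [evalC, bnd]
    exact ⟨h1.1.sin, h1.2.csin⟩
  | inv e ih =>
    intro hok z hz
    simp only [ok, Bool.and_eq_true, decide_eq_true_eq] at hok
    have h1 := ih hok.1 z hz
    simp only [evalC, bnd]
    exact ⟨h1.1.inv hok.2, h1.2.inv (ne_zero_of_lb h1.1 hok.2)⟩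
  | sqrt e ih =>
    intro hok z hz
    simp only [ok, Bool.and_eq_true] at hok
    have h1 := ih hok.1 z hz
    simp only [evalC, bnd]
    exact ⟨h1.1.sqrt hok.2, h1.2.cpow_const
      (Complex.mem_slitPlane_iff.mpr (Or.inl (re_pos_of_posOpt h1.1 hok.2)))⟩

/-- Analyticity of the factor in the strip. [cite: TrefethenWeideman2014, Thm. 5.1] -/
theorem differentiableOn_evalC {a : ℚ} {e : RExpr} (hok : ok a e = true) :
    DifferentiableOn ℂ (evalC e) {z : ℂ | |z.im| < a} :=
  fun z hz => ((sbx_evalC e hok z hz).2).differentiableWithinAt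

/-- The strip bound `|v(z)| ≤ U` when the certified upper bound is present.
[cite: TrefethenWeideman2014, Thm. 5.1] -/
theorem norm_evalC_le {a : ℚ} {e : RExpr} (hok : ok a e = true) {U : ℚ} (hU : (bnd a e).ub = some U)
    {z : ℂ} (hz : |z.im| < a) : ‖evalC e z‖ ≤ U := by
  have h := (sbx_evalC e hok z hz).1.norm_le
  rw [hU] at h
  simpa [UBnd] using h

/-- On the real axis the complex semantics is the real factor. [cite: TrefethenWeideman2014, Thm. 5.1] -/
theorem evalC_ofReal {a : ℚ} (ha : 0 < a) :
    ∀ (e : RExpr), ok a e = true → ∀ x : ℝ, evalC e (x : ℂ) = ((evalR e x : ℝ) : ℂ) := by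
  have hstrip : ∀ x : ℝ, |(x : ℂ).im| < a := fun x => by
    simp only [Complex.ofReal_im, abs_zero]
    exact_mod_cast ha
  intro e
  induction e with
  | const c => intro _ x; simp only [evalC, evalR]; push_cast; rfl
  | sq u => intro _ x; simp only [evalC, evalR]; push_cast; rfl
  | cosX q => intro _ x; simp only [evalC, evalR]; push_cast; rfl
  | sinX q => intro _ x; simp only [evalC, evalR]; push_cast; rfl
  | add e f ihe ihf =>
    intro hok x
    simp only [ok, Bool.and_eq_true] at hok
    simp only [evalC, evalR, ihe hok.1, ihf hok.2]
    push_cast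
    rfl
  | sub e f ihe ihf =>
    intro hok x
    simp only [ok, Bool.and_eq_true] at hok
    simp only [evalC, evalR, ihe hok.1, ihf hok.2]
    push_cast
    rfl
  | neg e ih =>
    intro hok x
    simp only [ok] at hok
    simp only [evalC, evalR, ih hok]
    push_cast
    rfl
  | mul e f ihe ihf =>
    intro hok x
    simp only [ok, Bool.and_eq_true] at hok
    simp only [evalC, evalR, ihe hok.1, ihf hok.2]
    push_cast
    rfl
  | exp e ih =>
    intro hok x
    simp only [ok] at hok
    simp only [evalC, evalR, ih hok]
    exact (Complex.ofReal_exp _).symm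
  | cos e ih =>
    intro hok x
    simp only [ok] at hok
    simp only [evalC, evalR, ih hok]
    exact (Complex.ofReal_cos _).symm
  | sin e ih =>
    intro hok x
    simp only [ok] at hok
    simp only [evalC, evalR, ih hok]
    exact (Complex.ofReal_sin _).symm
  | inv e ih =>
    intro hok x
    simp only [ok, Bool.and_eq_true, decide_eq_true_eq] at hok
    simp only [evalC, evalR, ih hok.1]
    exact (Complex.ofReal_inv _).symm
  | sqrt e ih =>
    intro hok x
    simp only [ok, Bool.and_eq_true] at hok
    have hpos : 0 ≤ evalR e x := by
      have h1 := re_pos_of_posOpt (sbx_evalC e hok.1 x (hstrip x)).1 hok.2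
      rw [ih hok.1, Complex.ofReal_re] at h1
      exact h1.le
    simp only [evalC, evalR, ih hok.1]
    rw [Real.sqrt_eq_rpow, Complex.ofReal_cpow hpos]


/-! ### Part C. The truncated trapezoidal rule on `ℝ` for `w(x) = e^{-c x²} v(x)`

With `U` the certified strip bound of the factor, the hypotheses of
`Literature.Analysis.Quadrature.norm_tsum_sub_integral_le_of_strip` are discharged with
`M = U·e^{c a²}·√(π/c)` (since `|e^{-c z²}| = e^{-c (x² - y²)} ≤ e^{c a²} e^{-c x²}` on the strip)
and decay exponent `b = 2`; the infinite trapezoidal sum is then truncated to `|k| ≤ n` with the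
Gaussian tail `2 h U e^{-c (n+1)² h²} / (1 - e^{-2 c h² (n+1)})`. -/

section Analysis

open MeasureTheory Filter Asymptotics

/-- The integrand continued into the strip: `w(z) = e^{-c z²} v(z)`.
[cite: TrefethenWeideman2014, Thm. 5.1] -/
noncomputable def wC (c : ℚ) (e : RExpr) (z : ℂ) : ℂ := Complex.exp (-(c : ℂ) * z ^ 2) * evalC e z

/-- The real integrand `w(x) = e^{-c x²} v(x)`. [cite: TrefethenWeideman2014, Thm. 5.1] -/
noncomputable def wR (c : ℚ) (e : RExpr) (x : ℝ) : ℝ := Real.exp (-(c : ℝ) * x ^ 2) * evalR e x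

/-- The truncated trapezoidal sum `T_n = w(0) + Σ_{m<n} (w((m+1)h) + w(-(m+1)h))`, so that
`h·T_n = h·Σ_{|k| ≤ n} w(kh)` is the truncated rule. [cite: TrefethenWeideman2014, Sect. 5 (5.4)] -/
noncomputable def truncSum (c : ℚ) (e : RExpr) (h : ℚ) (n : ℕ) : ℝ :=
  wR c e 0 + ∑ m ∈ Finset.range n,
    (wR c e (((m + 1 : ℕ) : ℝ) * h) + wR c e (-(((m + 1 : ℕ) : ℝ) * h)))

/-- `|e^{-c z²}| = e^{-c (x² - y²)}`. [folklore] -/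
private theorem norm_cexp_gauss (c : ℚ) (z : ℂ) :
    ‖Complex.exp (-(c : ℂ) * z ^ 2)‖ = Real.exp (-(c : ℝ) * (z.re ^ 2 - z.im ^ 2)) := by
  rw [Complex.norm_exp]
  congr 1
  rw [pow_two, neg_mul, Complex.neg_re, Complex.mul_re, Complex.mul_re, Complex.mul_im,
    Complex.ratCast_re, Complex.ratCast_im]
  ring

/-- The certified strip bound is nonnegative. [folklore] -/
private theorem ub_nonneg {a : ℚ} (ha : 0 < a) {e : RExpr} (hok : ok a e = true) {U : ℚ}
    (hU : (bnd a e).ub = some U) : (0 : ℝ) ≤ U :=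
  (norm_nonneg _).trans (norm_evalC_le hok hU (z := 0) (by simpa using ha))

/-- The strip estimate `|w(z)| ≤ U e^{c a²} e^{-c (Re z)²}` for `|Im z| < a`.
[cite: TrefethenWeideman2014, Thm. 5.1] -/
theorem norm_wC_le {c a : ℚ} (hc : 0 < c) {e : RExpr} (hok : ok a e = true) {U : ℚ}
    (hU : (bnd a e).ub = some U) {z : ℂ} (hz : |z.im| < a) :
    ‖wC c e z‖ ≤ U * Real.exp (c * a ^ 2) * Real.exp (-(c : ℝ) * z.re ^ 2) := by
  have hv := norm_evalC_le hok hU hz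
  have hc' : (0 : ℝ) < c := by exact_mod_cast hc
  have him : z.im ^ 2 ≤ (a : ℝ) ^ 2 := by
    rw [← sq_abs]
    exact pow_le_pow_left₀ (abs_nonneg _) hz.le 2
  have h1 : Real.exp (-(c : ℝ) * (z.re ^ 2 - z.im ^ 2)) ≤
      Real.exp (c * a ^ 2) * Real.exp (-(c : ℝ) * z.re ^ 2) := by
    rw [← Real.exp_add, Real.exp_le_exp]
    nlinarith
  rw [wC, norm_mul, norm_cexp_gauss]
  calc Real.exp (-(c : ℝ) * (z.re ^ 2 - z.im ^ 2)) * ‖evalC e z‖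
      ≤ Real.exp (c * a ^ 2) * Real.exp (-(c : ℝ) * z.re ^ 2) * U :=
        mul_le_mul h1 hv (norm_nonneg _) (by positivity)
    _ = U * Real.exp (c * a ^ 2) * Real.exp (-(c : ℝ) * z.re ^ 2) := by ring

/-- `w` is holomorphic in the strip. [cite: TrefethenWeideman2014, Thm. 5.1] -/
theorem differentiableOn_wC (c : ℚ) {a : ℚ} {e : RExpr} (hok : ok a e = true) :
    DifferentiableOn ℂ (wC c e) {z : ℂ | |z.im| < a} := by
  intro z hz
  have h1 : DifferentiableAt ℂ (fun z : ℂ => Complex.exp (-(c : ℂ) * z ^ 2)) z :=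
    ((differentiableAt_id.pow 2).const_mul _).cexp
  exact (h1.mul (sbx_evalC e hok z hz).2).differentiableWithinAt

/-- On the real axis `w` is the real integrand. [cite: TrefethenWeideman2014, Thm. 5.1] -/
theorem wC_ofReal (c : ℚ) {a : ℚ} (ha : 0 < a) {e : RExpr} (hok : ok a e = true) (x : ℝ) :
    wC c e (x : ℂ) = ((wR c e x : ℝ) : ℂ) := by
  rw [wC, wR, evalC_ofReal ha e hok x]
  push_cast
  ring

/-- Integrability of `w` on every horizontal line of the strip (dominated by a Gaussian).
[cite: TrefethenWeideman2014, Thm. 5.1] -/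
theorem integrable_wC_line {c a : ℚ} (hc : 0 < c) {e : RExpr} (hok : ok a e = true) {U : ℚ}
    (hU : (bnd a e).ub = some U) {y : ℝ} (hy : |y| < a) :
    Integrable fun x : ℝ => wC c e (x + y * Complex.I) := by
  have hc' : (0 : ℝ) < c := by exact_mod_cast hc
  have hmem : ∀ x : ℝ, ((x : ℂ) + y * Complex.I) ∈ {z : ℂ | |z.im| < a} := fun x => by
    simpa using hy
  have hcont : Continuous fun x : ℝ => wC c e (x + y * Complex.I) :=
    (differentiableOn_wC c hok).continuousOn.comp_continuous (by fun_prop) hmem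
  refine Integrable.mono' ((integrable_exp_neg_mul_sq hc').const_mul (U * Real.exp (c * a ^ 2)))
    hcont.aestronglyMeasurable (Eventually.of_forall fun x => ?_)
  have := norm_wC_le hc hok hU (z := x + y * Complex.I) (by simpa using hy)
  simpa using this

/-- The uniform line bound `∫ |w(x + iy)| dx ≤ U e^{c a²} √(π/c)` (`|y| < a`).
[cite: TrefethenWeideman2014, Thm. 5.1] -/
theorem integral_norm_wC_le {c a : ℚ} (hc : 0 < c) {e : RExpr} (hok : ok a e = true) {U : ℚ}
    (hU : (bnd a e).ub = some U) {y : ℝ} (hy : |y| < a) :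
    ∫ x : ℝ, ‖wC c e (x + y * Complex.I)‖ ≤ U * Real.exp (c * a ^ 2) * Real.sqrt (π / c) := by
  have hc' : (0 : ℝ) < c := by exact_mod_cast hc
  have hg : Integrable fun x : ℝ => U * Real.exp (c * a ^ 2) * Real.exp (-(c : ℝ) * x ^ 2) :=
    (integrable_exp_neg_mul_sq hc').const_mul _
  calc ∫ x : ℝ, ‖wC c e (x + y * Complex.I)‖
      ≤ ∫ x : ℝ, U * Real.exp (c * a ^ 2) * Real.exp (-(c : ℝ) * x ^ 2) :=
        integral_mono (integrable_wC_line hc hok hU hy).norm hg fun x => by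
          have := norm_wC_le hc hok hU (z := x + y * Complex.I) (by simpa using hy)
          simpa using this
    _ = U * Real.exp (c * a ^ 2) * Real.sqrt (π / c) := by
        rw [integral_const_mul, integral_gaussian]

/-- Uniform decay in the strip: `w(z) → 0` as `|Re z| → ∞`, `|Im z| < a`.
[cite: TrefethenWeideman2014, Thm. 5.1] -/
theorem wC_vanishing {c a : ℚ} (hc : 0 < c) {e : RExpr} (hok : ok a e = true) {U : ℚ}
    (hU : (bnd a e).ub = some U) :
    ∀ ε > 0, ∃ R : ℝ, ∀ z : ℂ, |z.im| < a → R ≤ |z.re| → ‖wC c e z‖ ≤ ε := by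
  intro ε hε
  have hc' : (0 : ℝ) < c := by exact_mod_cast hc
  set K : ℝ := U * Real.exp (c * a ^ 2) with hK
  refine ⟨max 1 (K / (c * ε)), fun z hz hR => ?_⟩
  have hR1 : 1 ≤ |z.re| := (le_max_left _ _).trans hR
  have hR2 : K / (c * ε) ≤ |z.re| := (le_max_right _ _).trans hR
  have h3 : |z.re| ≤ z.re ^ 2 := by
    rw [← sq_abs]
    nlinarith [abs_nonneg z.re]
  have h4 : K ≤ ε * ((c : ℝ) * z.re ^ 2) := by
    have h6 := (div_le_iff₀ (by positivity)).mp hR2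
    have h7 : |z.re| * ((c : ℝ) * ε) ≤ z.re ^ 2 * ((c : ℝ) * ε) :=
      mul_le_mul_of_nonneg_right h3 (by positivity)
    linarith
  have h5 : (c : ℝ) * z.re ^ 2 ≤ Real.exp ((c : ℝ) * z.re ^ 2) := by
    linarith [Real.add_one_le_exp ((c : ℝ) * z.re ^ 2)]
  calc ‖wC c e z‖ ≤ K * Real.exp (-(c : ℝ) * z.re ^ 2) := norm_wC_le hc hok hU hz
    _ ≤ ε := by
        rw [neg_mul, Real.exp_neg, ← div_eq_mul_inv, div_le_iff₀ (Real.exp_pos _)]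
        nlinarith [hε.le]

/-- Polynomial decay on the real axis: `w(x) = O(|x|^{-2})`.
[cite: TrefethenWeideman2014, Thm. 5.1] -/
theorem wC_isBigO {c a : ℚ} (hc : 0 < c) (ha : 0 < a) {e : RExpr} (hok : ok a e = true) {U : ℚ}
    (hU : (bnd a e).ub = some U) :
    (fun x : ℝ => wC c e x) =O[cocompact ℝ] fun x : ℝ => |x| ^ (-(2 : ℝ)) := by
  have hc' : (0 : ℝ) < c := by exact_mod_cast hc
  have hK0 : (0 : ℝ) ≤ U * Real.exp (c * a ^ 2) :=
    mul_nonneg (ub_nonneg ha hok hU) (Real.exp_pos _).le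
  refine IsBigO.of_bound (U * Real.exp (c * a ^ 2) / c) ?_
  filter_upwards [(isCompact_singleton (x := (0 : ℝ))).compl_mem_cocompact] with x hx
  have hx0 : x ≠ 0 := hx
  have hstrip : |(x : ℂ).im| < a := by simpa using ha
  have h1 := norm_wC_le hc hok hU hstrip
  simp only [Complex.ofReal_re] at h1
  have hx2 : 0 < x ^ 2 := by positivity
  have h2 : Real.exp (-(c : ℝ) * x ^ 2) ≤ ((c : ℝ) * x ^ 2)⁻¹ := by
    rw [neg_mul, Real.exp_neg]
    exact inv_anti₀ (by positivity) (by linarith [Real.add_one_le_exp ((c : ℝ) * x ^ 2)])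
  have h3 : ‖|x| ^ (-(2 : ℝ))‖ = (x ^ 2)⁻¹ := by
    rw [Real.rpow_neg (abs_nonneg x), Real.rpow_two, sq_abs, Real.norm_of_nonneg (by positivity)]
  rw [h3]
  calc ‖wC c e x‖ ≤ U * Real.exp (c * a ^ 2) * Real.exp (-(c : ℝ) * x ^ 2) := h1
    _ ≤ U * Real.exp (c * a ^ 2) * ((c : ℝ) * x ^ 2)⁻¹ := mul_le_mul_of_nonneg_left h2 hK0
    _ = U * Real.exp (c * a ^ 2) / c * (x ^ 2)⁻¹ := by
        rw [mul_inv]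
        ring

/-- **The trapezoidal rule on `ℝ` for `w(x) = e^{-c x²} v(x)`** (Trefethen–Weideman Theorem 5.1
specialised): `|h Σ_{k ∈ ℤ} w(kh) - ∫ w| ≤ 2 U e^{c a²} √(π/c) / (e^{2πa/h} - 1)`.
[cite: TrefethenWeideman2014, Thm. 5.1] -/
theorem abs_tsum_sub_integral_le {c a h : ℚ} (hc : 0 < c) (ha : 0 < a) (hh : 0 < h) {e : RExpr}
    (hok : ok a e = true) {U : ℚ} (hU : (bnd a e).ub = some U) :
    |(h : ℝ) * ∑' k : ℤ, wR c e (k * h) - ∫ x, wR c e x| ≤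
      2 * (U * Real.exp (c * a ^ 2) * Real.sqrt (π / c)) / (Real.exp (2 * π * a / h) - 1) := by
  have ha' : (0 : ℝ) < a := by exact_mod_cast ha
  have hh' : (0 : ℝ) < h := by exact_mod_cast hh
  have key := Literature.Analysis.Quadrature.norm_tsum_sub_integral_le_of_strip (w := wC c e)
    (a := (a : ℝ)) (h := (h : ℝ)) ha' hh' (differentiableOn_wC c hok)
    (fun y hy => integrable_wC_line hc hok hU hy) (fun y hy => integral_norm_wC_le hc hok hU hy)
    (wC_vanishing hc hok hU) one_lt_two (wC_isBigO hc ha hok hU)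
  have hsum : (∑' k : ℤ, wC c e (k * (h : ℝ))) = (((∑' k : ℤ, wR c e (k * h)) : ℝ) : ℂ) := by
    rw [Complex.ofReal_tsum]
    refine tsum_congr fun k => ?_
    rw [← wC_ofReal c ha hok]
    push_cast
    ring_nf
  have hint : (∫ x : ℝ, wC c e x) = (((∫ x, wR c e x) : ℝ) : ℂ) := by
    rw [← integral_complex_ofReal]
    exact integral_congr_ae (Eventually.of_forall fun x => wC_ofReal c ha hok x)
  rw [hsum, hint, ← Complex.ofReal_mul, ← Complex.ofReal_sub, Complex.norm_real,
    Real.norm_eq_abs] at key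
  exact key

/-- The real-axis bound `|w(x)| ≤ U e^{-c x²}`. [cite: TrefethenWeideman2014, Thm. 5.1] -/
theorem abs_wR_le (c : ℚ) {a : ℚ} (ha : 0 < a) {e : RExpr} (hok : ok a e = true) {U : ℚ}
    (hU : (bnd a e).ub = some U) (x : ℝ) : |wR c e x| ≤ U * Real.exp (-(c : ℝ) * x ^ 2) := by
  have hstrip : |(x : ℂ).im| < a := by simpa using ha
  have h1 := norm_evalC_le hok hU hstrip
  rw [evalC_ofReal ha e hok x, Complex.norm_real, Real.norm_eq_abs] at h1
  rw [wR, abs_mul, abs_of_pos (Real.exp_pos _), mul_comm]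
  exact mul_le_mul_of_nonneg_right h1 (Real.exp_pos _).le

/-- The Gaussian tail majorant: `|w(±(m+N)h)| ≤ U e^{-c N² h²} (e^{-2 c h² N})^m`. [folklore] -/
private theorem tail_le {c a h : ℚ} (hc : 0 < c) (ha : 0 < a) {e : RExpr} (hok : ok a e = true)
    {U : ℚ} (hU : (bnd a e).ub = some U) (N m : ℕ) {x : ℝ}
    (hx : x ^ 2 = (((m : ℝ) + N) * h) ^ 2) :
    ‖wR c e x‖ ≤ U * Real.exp (-(c : ℝ) * ((N : ℝ) * h) ^ 2) *
      Real.exp (-(2 * c * h ^ 2 * N)) ^ m := by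
  have hc' : (0 : ℝ) ≤ c := le_of_lt (by exact_mod_cast hc)
  have hU0 := ub_nonneg ha hok hU
  rw [Real.norm_eq_abs]
  calc |wR c e x| ≤ U * Real.exp (-(c : ℝ) * x ^ 2) := abs_wR_le c ha hok hU x
    _ ≤ U * (Real.exp (-(c : ℝ) * ((N : ℝ) * h) ^ 2) * Real.exp (-(2 * c * h ^ 2 * N)) ^ m) := by
        refine mul_le_mul_of_nonneg_left ?_ hU0
        rw [hx, ← Real.exp_nat_mul, ← Real.exp_add, Real.exp_le_exp]
        nlinarith [mul_nonneg hc' (sq_nonneg ((m : ℝ) * h))]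
    _ = _ := by ring

/-- **Truncation of the trapezoidal sum**: the two Gaussian tails beyond `|k| ≤ n` contribute at
most `2 U e^{-c (n+1)² h²} / (1 - e^{-2 c h² (n+1)})` (the truncation error is governed by the size of
the integrand at the truncation points). [cite: TrefethenWeideman2014, Sect. 6] -/
theorem abs_truncSum_sub_tsum_le {c a h : ℚ} (hc : 0 < c) (ha : 0 < a) (hh : 0 < h) {e : RExpr}
    (hok : ok a e = true) {U : ℚ} (hU : (bnd a e).ub = some U) (n : ℕ) :
    |truncSum c e h n - ∑' k : ℤ, wR c e (k * h)| ≤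
      2 * (U * Real.exp (-(c : ℝ) * (((n + 1 : ℕ) : ℝ) * h) ^ 2) /
        (1 - Real.exp (-(2 * c * h ^ 2 * (n + 1 : ℕ))))) := by
  have hc' : (0 : ℝ) < c := by exact_mod_cast hc
  have hh' : (0 : ℝ) < h := by exact_mod_cast hh
  set P : ℕ → ℝ := fun m => wR c e (((m + 1 : ℕ) : ℝ) * h) with hP
  set Q : ℕ → ℝ := fun m => wR c e (-(((m + 1 : ℕ) : ℝ) * h)) with hQ
  -- the geometric majorants
  have geo : ∀ N : ℕ, 0 < N → HasSum (fun m : ℕ => U * Real.exp (-(c : ℝ) * ((N : ℝ) * h) ^ 2) *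
      Real.exp (-(2 * c * h ^ 2 * N)) ^ m)
      (U * Real.exp (-(c : ℝ) * ((N : ℝ) * h) ^ 2) / (1 - Real.exp (-(2 * c * h ^ 2 * N)))) := by
    intro N hN
    have hN' : (0 : ℝ) < N := by exact_mod_cast hN
    have hq0 : 0 ≤ Real.exp (-(2 * c * h ^ 2 * N)) := (Real.exp_pos _).le
    have hq1 : Real.exp (-(2 * c * h ^ 2 * N)) < 1 := by
      rw [Real.exp_lt_one_iff]
      have : 0 < 2 * (c : ℝ) * h ^ 2 * N := by positivity
      linarith
    have := (hasSum_geometric_of_lt_one hq0 hq1).mul_left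
      (U * Real.exp (-(c : ℝ) * ((N : ℝ) * h) ^ 2))
    simpa [div_eq_mul_inv] using this
  have hPs : Summable P :=
    Summable.of_norm_bounded (geo 1 one_pos).summable fun m =>
      tail_le hc ha hok hU 1 m (by push_cast; ring)
  have hQs : Summable Q :=
    Summable.of_norm_bounded (geo 1 one_pos).summable fun m =>
      tail_le hc ha hok hU 1 m (by push_cast; ring)
  -- the tails beyond `n`
  have hPt : ‖∑' m, P (m + n)‖ ≤ U * Real.exp (-(c : ℝ) * (((n + 1 : ℕ) : ℝ) * h) ^ 2) /
      (1 - Real.exp (-(2 * c * h ^ 2 * (n + 1 : ℕ)))) :=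
    tsum_of_norm_bounded (geo (n + 1) (Nat.succ_pos n)) fun m =>
      tail_le hc ha hok hU (n + 1) m (by push_cast; ring)
  have hQt : ‖∑' m, Q (m + n)‖ ≤ U * Real.exp (-(c : ℝ) * (((n + 1 : ℕ) : ℝ) * h) ^ 2) /
      (1 - Real.exp (-(2 * c * h ^ 2 * (n + 1 : ℕ)))) :=
    tsum_of_norm_bounded (geo (n + 1) (Nat.succ_pos n)) fun m =>
      tail_le hc ha hok hU (n + 1) m (by push_cast; ring)
  -- the decomposition `Σ_ℤ = Σ_{k ≥ 1} + w(0) + Σ_{k ≤ -1}`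
  have h1 : HasSum (fun m : ℕ => wR c e ((((m : ℤ) + 1 : ℤ) : ℝ) * h)) (∑' m, P m) := by
    have e1 : (fun m : ℕ => wR c e ((((m : ℤ) + 1 : ℤ) : ℝ) * h)) = P := by
      funext m
      simp only [hP]
      push_cast
      ring_nf
    rw [e1]
    exact hPs.hasSum
  have h2 : HasSum (fun m : ℕ => wR c e (((-((m : ℤ) + 1) : ℤ) : ℝ) * h)) (∑' m, Q m) := by
    have e2 : (fun m : ℕ => wR c e (((-((m : ℤ) + 1) : ℤ) : ℝ) * h)) = Q := by
      funext m
      simp only [hQ]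
      push_cast
      ring_nf
    rw [e2]
    exact hQs.hasSum
  have hval : ∑' k : ℤ, wR c e (k * h) = (∑' m, P m) + wR c e 0 + ∑' m, Q m := by
    have := (HasSum.of_add_one_of_neg_add_one (f := fun k : ℤ => wR c e (k * h)) h1 h2).tsum_eq
    simpa using this
  have hsP := hPs.sum_add_tsum_nat_add n
  have hsQ := hQs.sum_add_tsum_nat_add n
  have htr : truncSum c e h n =
      wR c e 0 + ((∑ i ∈ Finset.range n, P i) + ∑ i ∈ Finset.range n, Q i) := by
    rw [truncSum, ← Finset.sum_add_distrib]
  have hdiff : truncSum c e h n - ∑' k : ℤ, wR c e (k * h) =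
      -(∑' i, P (i + n)) - ∑' i, Q (i + n) := by
    rw [htr, hval]
    linarith
  rw [hdiff, ← Real.norm_eq_abs]
  calc ‖-(∑' i, P (i + n)) - ∑' i, Q (i + n)‖
      ≤ ‖-(∑' i, P (i + n))‖ + ‖∑' i, Q (i + n)‖ := norm_sub_le _ _
    _ = ‖∑' i, P (i + n)‖ + ‖∑' i, Q (i + n)‖ := by rw [norm_neg]
    _ ≤ _ := add_le_add hPt hQt
    _ = _ := by ring

/-- **The truncated trapezoidal rule on the real line with a certified error**: for
`w(x) = e^{-c x²} v(x)` with `v` admissible (`ok a e`, strip bound `U`),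
`|h T_n - ∫_ℝ w| ≤ 2 U e^{c a²} √(π/c) / (e^{2πa/h} - 1) + 2 h U e^{-c (n+1)² h²}/(1 - e^{-2ch²(n+1)})`
— discretization error (Theorem 5.1) plus truncation error.
[cite: TrefethenWeideman2014, Thm. 5.1] [cite: TrefethenWeideman2014, Sect. 6] -/
theorem abs_truncSum_sub_integral_le {c a h : ℚ} (hc : 0 < c) (ha : 0 < a) (hh : 0 < h)
    {e : RExpr} (hok : ok a e = true) {U : ℚ} (hU : (bnd a e).ub = some U) (n : ℕ) :
    |(h : ℝ) * truncSum c e h n - ∫ x, wR c e x| ≤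
      2 * (U * Real.exp (c * a ^ 2) * Real.sqrt (π / c)) / (Real.exp (2 * π * a / h) - 1) +
      2 * ((h : ℝ) * U) * Real.exp (-(c : ℝ) * (((n + 1 : ℕ) : ℝ) * h) ^ 2) /
        (1 - Real.exp (-(2 * c * h ^ 2 * (n + 1 : ℕ)))) := by
  have h1 := abs_tsum_sub_integral_le hc ha hh hok hU
  have h2 := abs_truncSum_sub_tsum_le hc ha hh hok hU n
  have hh' : (0 : ℝ) ≤ h := le_of_lt (by exact_mod_cast hh)
  have h3 : |(h : ℝ) * truncSum c e h n - (h : ℝ) * ∑' k : ℤ, wR c e (k * h)| ≤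
      (h : ℝ) * (2 * (U * Real.exp (-(c : ℝ) * (((n + 1 : ℕ) : ℝ) * h) ^ 2) /
        (1 - Real.exp (-(2 * c * h ^ 2 * (n + 1 : ℕ)))))) := by
    rw [← mul_sub, abs_mul, abs_of_nonneg hh']
    exact mul_le_mul_of_nonneg_left h2 hh'
  calc |(h : ℝ) * truncSum c e h n - ∫ x, wR c e x|
      ≤ |(h : ℝ) * truncSum c e h n - (h : ℝ) * ∑' k : ℤ, wR c e (k * h)| +
          |(h : ℝ) * ∑' k : ℤ, wR c e (k * h) - ∫ x, wR c e x| := abs_sub_le _ _ _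
    _ ≤ _ := add_le_add h3 h1
    _ = _ := by ring

end Analysis

/-! ### Part D. The arithmetic kernel and the certificate -/

/-- The rational `q` as an interval at scale `S`. [cite: Moore1979, Sect. 3.3] -/
def ofRat (S : ℕ) (q : ℚ) : MI := MI.ofFrac S q.num q.den

/-- Soundness of `ofRat`. [cite: Moore1979, Thm. 3.1] -/
theorem mem_ofRat (S : ℕ) (q : ℚ) : MI.mem S (q : ℝ) (ofRat S q) := by
  rw [Rat.cast_def]
  exact MI.mem_ofFrac S q.num q.den_pos

/-- Transport of membership along an equality of reals. [folklore] -/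
private theorem mem_of_eq {S : ℕ} {x y : ℝ} {I : MI} (h : x = y) (hy : MI.mem S y I) :
    MI.mem S x I := h ▸ hy

/-- Interval evaluation of the factor `v` at a rational node `x`, by structural recursion
(`none` if a reciprocal, square root or exponential kernel declines).
[cite: Moore1979, Sect. 4.4 (4.11)] -/
def evalMIR (S K k : ℕ) (piI : MI) (x : ℚ) : RExpr → Option MI
  | .const c => some (ofRat S c)
  | .sq u => some (ofRat S ((x - u) ^ 2))
  | .cosX q =>
    match MC.expI S K k piI (ofRat S (q * x)) with
    | some W => some W.re
    | none => none
  | .sinX q =>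
    match MC.expI S K k piI (ofRat S (q * x)) with
    | some W => some W.im
    | none => none
  | .add e f =>
    match evalMIR S K k piI x e, evalMIR S K k piI x f with
    | some A, some B => some (A.add B)
    | _, _ => none
  | .sub e f =>
    match evalMIR S K k piI x e, evalMIR S K k piI x f with
    | some A, some B => some (A.sub B)
    | _, _ => none
  | .neg e =>
    match evalMIR S K k piI x e with
    | some A => some A.neg
    | none => none
  | .mul e f =>
    match evalMIR S K k piI x e, evalMIR S K k piI x f with
    | some A, some B => some (MI.mul S A B)
    | _, _ => none
  | .exp e =>
    match evalMIR S K k piI x e with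
    | some A => MI.exp S K k A
    | none => none
  | .cos e =>
    match evalMIR S K k piI x e with
    | some A =>
      match MC.expI S K k piI A with
      | some W => some W.re
      | none => none
    | none => none
  | .sin e =>
    match evalMIR S K k piI x e with
    | some A =>
      match MC.expI S K k piI A with
      | some W => some W.im
      | none => none
    | none => none
  | .inv e =>
    match evalMIR S K k piI x e with
    | some A => invI S A
    | none => none
  | .sqrt e =>
    match evalMIR S K k piI x e with
    | some A => sqrtI S A
    | none => none

/-- **Soundness of the interval evaluator** at a rational node.
[cite: Moore1979, Thm. 3.1] -/
theorem mem_evalMIR {S K k : ℕ} (hS : 0 < S) {piI : MI} (hpi : MI.mem S Real.pi piI) (x : ℚ) :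
    ∀ (e : RExpr) {Y : MI}, evalMIR S K k piI x e = some Y → MI.mem S (evalR e x) Y := by
  intro e
  induction e with
  | const c =>
    intro Y h
    simp only [evalMIR, Option.some.injEq] at h
    subst h
    exact mem_ofRat S c
  | sq u =>
    intro Y h
    simp only [evalMIR, Option.some.injEq] at h
    subst h
    simp only [evalR]
    exact mem_of_eq (by push_cast; ring) (mem_ofRat S ((x - u) ^ 2))
  | cosX q =>
    intro Y h
    simp only [evalMIR] at h
    split at h
    · rename_i W hW
      simp only [Option.some.injEq] at h
      subst h
      have h1 := (MC.mem_expI hS hpi hW (mem_ofRat S (q * x))).1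
      rw [Complex.exp_ofReal_mul_I_re] at h1
      simp only [evalR]
      exact mem_of_eq (by push_cast; ring_nf) h1
    · simp at h
  | sinX q =>
    intro Y h
    simp only [evalMIR] at h
    split at h
    · rename_i W hW
      simp only [Option.some.injEq] at h
      subst h
      have h1 := (MC.mem_expI hS hpi hW (mem_ofRat S (q * x))).2
      rw [Complex.exp_ofReal_mul_I_im] at h1
      simp only [evalR]
      exact mem_of_eq (by push_cast; ring_nf) h1
    · simp at h
  | add e f ihe ihf =>
    intro Y h
    simp only [evalMIR] at h
    split at h
    · rename_i A B hA hB
      simp only [Option.some.injEq] at h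
      subst h
      exact MI.mem_add (ihe hA) (ihf hB)
    · simp at h
  | sub e f ihe ihf =>
    intro Y h
    simp only [evalMIR] at h
    split at h
    · rename_i A B hA hB
      simp only [Option.some.injEq] at h
      subst h
      exact MI.mem_sub (ihe hA) (ihf hB)
    · simp at h
  | neg e ih =>
    intro Y h
    simp only [evalMIR] at h
    split at h
    · rename_i A hA
      simp only [Option.some.injEq] at h
      subst h
      exact MI.mem_neg (ih hA)
    · simp at h
  | mul e f ihe ihf =>
    intro Y h
    simp only [evalMIR] at h
    split at h
    · rename_i A B hA hB
      simp only [Option.some.injEq] at h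
      subst h
      exact MI.mem_mul hS (ihe hA) (ihf hB)
    · simp at h
  | exp e ih =>
    intro Y h
    simp only [evalMIR] at h
    split at h
    · rename_i A hA
      exact MI.mem_exp hS h (ih hA)
    · simp at h
  | cos e ih =>
    intro Y h
    simp only [evalMIR] at h
    split at h
    · rename_i A hA
      split at h
      · rename_i W hW
        simp only [Option.some.injEq] at h
        subst h
        have h1 := (MC.mem_expI hS hpi hW (ih hA)).1
        rw [Complex.exp_ofReal_mul_I_re] at h1
        simpa [evalR] using h1
      · simp at h
    · simp at h
  | sin e ih =>
    intro Y h
    simp only [evalMIR] at h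
    split at h
    · rename_i A hA
      split at h
      · rename_i W hW
        simp only [Option.some.injEq] at h
        subst h
        have h1 := (MC.mem_expI hS hpi hW (ih hA)).2
        rw [Complex.exp_ofReal_mul_I_im] at h1
        simpa [evalR] using h1
      · simp at h
    · simp at h
  | inv e ih =>
    intro Y h
    simp only [evalMIR] at h
    split at h
    · rename_i A hA
      exact mem_invI hS h (ih hA)
    · simp at h
  | sqrt e ih =>
    intro Y h
    simp only [evalMIR] at h
    split at h
    · rename_i A hA
      exact mem_sqrtI hS h (ih hA)
    · simp at h

/-- Interval enclosure of the integrand `w(x) = e^{-c x²} v(x)` at a rational node.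
[cite: Moore1979, Sect. 4.4 (4.11)] -/
def wMI (S K k : ℕ) (piI : MI) (c : ℚ) (e : RExpr) (x : ℚ) : Option MI :=
  match MI.exp S K k (ofRat S (-(c * x ^ 2))), evalMIR S K k piI x e with
  | some G, some Y => some (MI.mul S G Y)
  | _, _ => none

/-- Soundness of `wMI`. [cite: Moore1979, Thm. 3.1] -/
theorem mem_wMI {S K k : ℕ} (hS : 0 < S) {piI : MI} (hpi : MI.mem S Real.pi piI) (c : ℚ)
    (e : RExpr) (x : ℚ) {W : MI} (h : wMI S K k piI c e x = some W) :
    MI.mem S (wR c e x) W := by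
  unfold wMI at h
  split at h
  · rename_i G Y hG hY
    simp only [Option.some.injEq] at h
    subst h
    have h1 : MI.mem S (Real.exp (-(c : ℝ) * (x : ℝ) ^ 2)) G :=
      MI.mem_exp hS hG (mem_of_eq (by push_cast; ring) (mem_ofRat S (-(c * x ^ 2))))
    exact MI.mem_mul hS h1 (mem_evalMIR hS hpi x e hY)
  · simp at h

/-- The symmetric pair of samples `w((m+1)h) + w(−(m+1)h)` of the truncated rule.
[cite: TrefethenWeideman2014, Sect. 5 (5.4)] -/
noncomputable def pairR (c : ℚ) (e : RExpr) (h : ℚ) (m : ℕ) : ℝ :=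
  wR c e (((m + 1 : ℕ) : ℝ) * h) + wR c e (-(((m + 1 : ℕ) : ℝ) * h))

/-- Interval enclosure of the pair of samples at `±(m+1)h`. [cite: Moore1979, Sect. 4.4 (4.11)] -/
def pairMI (S K k : ℕ) (piI : MI) (c : ℚ) (e : RExpr) (h : ℚ) (m : ℕ) : Option MI :=
  match wMI S K k piI c e ((m + 1 : ℕ) * h), wMI S K k piI c e (-((m + 1 : ℕ) * h)) with
  | some A, some B => some (A.add B)
  | _, _ => none

/-- Soundness of `pairMI`. [cite: Moore1979, Thm. 3.1] -/
theorem mem_pairMI {S K k : ℕ} (hS : 0 < S) {piI : MI} (hpi : MI.mem S Real.pi piI) (c : ℚ)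
    (e : RExpr) (h : ℚ) (m : ℕ) {P : MI} (hP : pairMI S K k piI c e h m = some P) :
    MI.mem S (pairR c e h m) P := by
  unfold pairMI at hP
  split at hP
  · rename_i A B hA hB
    simp only [Option.some.injEq] at hP
    subst hP
    unfold pairR
    refine MI.mem_add ?_ ?_
    · exact mem_of_eq (by push_cast; ring) (mem_wMI hS hpi c e _ hA)
    · exact mem_of_eq (by push_cast; ring) (mem_wMI hS hpi c e _ hB)
  · simp at hP

/-- Linear interval sum of the pairs `s, …, s + l − 1` (the fuel-zero fallback of `blockSum`).
[cite: DavisRabinowitz1984, Sect. 3.4 (3.4.1a)] -/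
def linSum (S K k : ℕ) (piI : MI) (c : ℚ) (e : RExpr) (h : ℚ) (s : ℕ) : ℕ → Option MI
  | 0 => some (MI.ofInt S 0)
  | l + 1 =>
    match linSum S K k piI c e h s l, pairMI S K k piI c e h (s + l) with
    | some A, some P => some (A.add P)
    | _, _ => none

/-- Soundness of `linSum`. [cite: Moore1979, Thm. 3.1] -/
theorem mem_linSum {S K k : ℕ} (hS : 0 < S) {piI : MI} (hpi : MI.mem S Real.pi piI) (c : ℚ)
    (e : RExpr) (h : ℚ) (s : ℕ) : ∀ (l : ℕ) {T : MI}, linSum S K k piI c e h s l = some T →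
      MI.mem S (∑ i ∈ Finset.range l, pairR c e h (s + i)) T
  | 0, T, hT => by
    simp only [linSum, Option.some.injEq] at hT
    subst hT
    simpa using MI.mem_ofInt S 0
  | l + 1, T, hT => by
    simp only [linSum] at hT
    split at hT
    · rename_i A P hA hP
      simp only [Option.some.injEq] at hT
      subst hT
      rw [Finset.sum_range_succ]
      exact MI.mem_add (mem_linSum hS hpi c e h s l hA) (mem_pairMI hS hpi c e h (s + l) hP)
    · simp at hT

/-- Balanced (binary-splitting) interval sum of the pairs `s, …, s + l − 1` with recursion fuel `d` (structural,
so that the kernel unfolds it): the kernel then evaluates an expression tree of depth `O(d + log l)` instead of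
a chain of `l` pending additions (pairwise summation; the enclosure is the same, integer addition being exact).
[cite: DavisRabinowitz1984, Sect. 3.4 (3.4.1a)] -/
def blockSum (S K k : ℕ) (piI : MI) (c : ℚ) (e : RExpr) (h : ℚ) : ℕ → ℕ → ℕ → Option MI
  | 0, s, l => linSum S K k piI c e h s l
  | _ + 1, _, 0 => some (MI.ofInt S 0)
  | _ + 1, s, 1 => pairMI S K k piI c e h s
  | d + 1, s, l + 2 =>
    match blockSum S K k piI c e h d s ((l + 2) / 2),
      blockSum S K k piI c e h d (s + (l + 2) / 2) (l + 2 - (l + 2) / 2) with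
    | some A, some B => some (A.add B)
    | _, _ => none

/-- Soundness of `blockSum`. [cite: Moore1979, Thm. 3.1] -/
theorem mem_blockSum {S K k : ℕ} (hS : 0 < S) {piI : MI} (hpi : MI.mem S Real.pi piI) (c : ℚ)
    (e : RExpr) (h : ℚ) : ∀ (d s l : ℕ) {T : MI}, blockSum S K k piI c e h d s l = some T →
      MI.mem S (∑ i ∈ Finset.range l, pairR c e h (s + i)) T
  | 0, s, l, T, hT => by
    simp only [blockSum] at hT
    exact mem_linSum hS hpi c e h s l hT
  | d + 1, s, 0, T, hT => by
    simp only [blockSum, Option.some.injEq] at hT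
    subst hT
    simpa using MI.mem_ofInt S 0
  | d + 1, s, 1, T, hT => by
    simp only [blockSum] at hT
    simpa using mem_pairMI hS hpi c e h s hT
  | d + 1, s, l + 2, T, hT => by
    simp only [blockSum] at hT
    split at hT
    · rename_i A B hA hB
      simp only [Option.some.injEq] at hT
      subst hT
      have ih1 := mem_blockSum hS hpi c e h d s ((l + 2) / 2) hA
      have ih2 := mem_blockSum hS hpi c e h d (s + (l + 2) / 2) (l + 2 - (l + 2) / 2) hB
      have hl : (l + 2) / 2 + (l + 2 - (l + 2) / 2) = l + 2 := by omega
      rw [← hl, Finset.sum_range_add]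
      simp only [add_assoc] at ih2
      exact MI.mem_add ih1 ih2
    · simp at hT

/-- The truncated trapezoidal sum `T_n` in interval arithmetic: the central sample plus the balanced sum of the
`n` symmetric pairs (`none` if a kernel declines). [cite: DavisRabinowitz1984, Sect. 3.4 (3.4.1a)] -/
def rtSum (S K k : ℕ) (piI : MI) (c : ℚ) (e : RExpr) (h : ℚ) (n : ℕ) : Option MI :=
  match wMI S K k piI c e 0, blockSum S K k piI c e h 64 0 n with
  | some A, some T => some (A.add T)
  | _, _ => none

/-- Soundness of `rtSum`. [cite: Moore1979, Thm. 3.1] -/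
theorem mem_rtSum {S K k : ℕ} (hS : 0 < S) {piI : MI} (hpi : MI.mem S Real.pi piI) (c : ℚ)
    (e : RExpr) (h : ℚ) (n : ℕ) {T : MI} (hT : rtSum S K k piI c e h n = some T) :
    MI.mem S (truncSum c e h n) T := by
  unfold rtSum at hT
  split at hT
  · rename_i A B hA hB
    simp only [Option.some.injEq] at hT
    subst hT
    have h0 := mem_wMI hS hpi c e 0 hA
    have h1 := mem_blockSum hS hpi c e h 64 0 n hB
    simp only [zero_add] at h1
    have e1 : truncSum c e h n = wR c e 0 + ∑ i ∈ Finset.range n, pairR c e h i := rfl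
    rw [e1]
    refine MI.mem_add ?_ h1
    simpa using h0
  · simp at hT

/-- Enclosure of the discretization error `2 U e^{c a²} √(π/c) / (e^{2πa/h} - 1)`.
[cite: TrefethenWeideman2014, Thm. 5.1] -/
def discErrMI (S K k : ℕ) (piI : MI) (c a h U : ℚ) : Option MI :=
  match MI.exp S K k (ofRat S (c * a ^ 2)), sqrtI S (MI.mul S piI (ofRat S (1 / c))),
    MI.exp S K k (MI.mul S piI (ofRat S (2 * a / h))) with
  | some G, some R, some E =>
    MI.divPos S (MI.mul S (MI.mul S (ofRat S (2 * U)) G) R) (E.sub (MI.ofInt S 1))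
  | _, _, _ => none

/-- Soundness of `discErrMI`. [cite: Moore1979, Thm. 3.1] -/
theorem mem_discErrMI {S K k : ℕ} (hS : 0 < S) {piI : MI} (hpi : MI.mem S Real.pi piI)
    {c a h U : ℚ} {Y : MI} (hY : discErrMI S K k piI c a h U = some Y) :
    MI.mem S (2 * (U * Real.exp (c * a ^ 2) * Real.sqrt (π / c)) / (Real.exp (2 * π * a / h) - 1))
      Y := by
  unfold discErrMI at hY
  split at hY
  · rename_i G R E hG hR hE
    have h1 : MI.mem S (Real.exp ((c : ℝ) * a ^ 2)) G :=
      MI.mem_exp hS hG (mem_of_eq (by push_cast; ring) (mem_ofRat S (c * a ^ 2)))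
    have h2 : MI.mem S (Real.sqrt (π / c)) R :=
      mem_sqrtI hS hR (mem_of_eq (by push_cast; ring) (MI.mem_mul hS hpi (mem_ofRat S (1 / c))))
    have h3 : MI.mem S (Real.exp (2 * π * a / h) - 1) (E.sub (MI.ofInt S 1)) := by
      refine MI.mem_sub (MI.mem_exp hS hE (mem_of_eq (by push_cast; ring)
        (MI.mem_mul hS hpi (mem_ofRat S (2 * a / h))))) ?_
      simpa using MI.mem_ofInt S 1
    have h4 : MI.mem S (2 * (U * Real.exp (c * a ^ 2) * Real.sqrt (π / c)))
        (MI.mul S (MI.mul S (ofRat S (2 * U)) G) R) :=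
      mem_of_eq (by push_cast; ring) (MI.mem_mul hS (MI.mem_mul hS (mem_ofRat S (2 * U)) h1) h2)
    exact MI.mem_divPos hS hY h4 h3
  · simp at hY

/-- Enclosure of the truncation error `2 h U e^{-c (n+1)² h²} / (1 - e^{-2 c h² (n+1)})`, computed
as `2 h U / (e^{c (n+1)² h²} (1 - e^{-2 c h² (n+1)}))` so that the tiny Gaussian factor is a large
divisor (full relative precision at fixed absolute scale). [cite: TrefethenWeideman2014, Sect. 6] -/
def truncErrMI (S K k : ℕ) (c h U : ℚ) (n : ℕ) : Option MI :=
  match MI.exp S K k (ofRat S (c * ((n + 1 : ℕ) * h) ^ 2)),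
    MI.exp S K k (ofRat S (-(2 * c * h ^ 2 * (n + 1 : ℕ)))) with
  | some G, some E => MI.divPos S (ofRat S (2 * (h * U))) (MI.mul S G ((MI.ofInt S 1).sub E))
  | _, _ => none

/-- Soundness of `truncErrMI`. [cite: Moore1979, Thm. 3.1] -/
theorem mem_truncErrMI {S K k : ℕ} (hS : 0 < S) {c h U : ℚ} {n : ℕ} {Y : MI}
    (hY : truncErrMI S K k c h U n = some Y) :
    MI.mem S (2 * ((h : ℝ) * U) * Real.exp (-(c : ℝ) * (((n + 1 : ℕ) : ℝ) * h) ^ 2) /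
      (1 - Real.exp (-(2 * c * h ^ 2 * (n + 1 : ℕ))))) Y := by
  unfold truncErrMI at hY
  split at hY
  · rename_i G E hG hE
    have h1 : MI.mem S (Real.exp ((c : ℝ) * (((n + 1 : ℕ) : ℝ) * h) ^ 2)) G :=
      MI.mem_exp hS hG (mem_of_eq (by push_cast; ring) (mem_ofRat S _))
    have h2 : MI.mem S (1 - Real.exp (-(2 * c * h ^ 2 * (n + 1 : ℕ)))) ((MI.ofInt S 1).sub E) := by
      refine MI.mem_sub (by simpa using MI.mem_ofInt S 1)
        (MI.mem_exp hS hE (mem_of_eq (by push_cast; ring) (mem_ofRat S _)))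
    have h3 : MI.mem S (2 * ((h : ℝ) * U)) (ofRat S (2 * (h * U))) :=
      mem_of_eq (by push_cast; ring) (mem_ofRat S _)
    have h4 := MI.mem_divPos hS hY h3 (MI.mem_mul hS h1 h2)
    refine mem_of_eq ?_ h4
    rw [neg_mul, Real.exp_neg, ← div_eq_mul_inv, div_div]
  · simp at hY

/-- The certificate data: the enclosure of `h·T_n` and of the total error radius, at scale `S`
(`none` if the strip bound is absent or a kernel declines).
[cite: TrefethenWeideman2014, Thm. 5.1] -/
def rtData (e : RExpr) (c a h : ℚ) (n S K k : ℕ) : Option (MI × MI) :=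
  match (bnd a e).ub, MI.pi S K with
  | some U, some piI =>
    match rtSum S K k piI c e h n, discErrMI S K k piI c a h U, truncErrMI S K k c h U n with
    | some T, some E₁, some E₂ => some (MI.mul S (ofRat S h) T, E₁.add E₂)
    | _, _, _ => none
  | _, _ => none

/-- **The certificate.**  `rtCheck e c a h n S K k lo hi` checks, by integer arithmetic only:
`c, a, h, S > 0`, the side conditions `ok a e`, and that the interval `h·T_n ± E` computed at scale
`S` lies inside `[lo, hi]`. [cite: TrefethenWeideman2014, Thm. 5.1] -/
def rtCheck (e : RExpr) (c a h : ℚ) (n S K k : ℕ) (lo hi : ℚ) : Bool :=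
  decide (0 < c) && decide (0 < a) && decide (0 < h) && ok a e && decide (0 < S) &&
    match rtData e c a h n S K k with
    | none => false
    | some D =>
      decide (lo.num * (S : ℤ) ≤ (D.1.lo - D.2.hi) * (lo.den : ℤ)) &&
        decide ((D.1.hi + D.2.hi) * (hi.den : ℤ) ≤ hi.num * (S : ℤ))

/-- **Kernel-checked enclosure of a real-line integral.**  One `decide` of `rtCheck` proves
`lo ≤ ∫_ℝ e^{-c x²} v(x) dx ≤ hi` for the real factor `v = evalR e`: the truncated trapezoidal value
in outward-rounded interval arithmetic plus the certified error of Part C (exponentially small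
discretization error of Theorem 5.1 plus the Gaussian truncation tail).
[cite: TrefethenWeideman2014, Thm. 5.1] [cite: Moore1979, Thm. 3.1] -/
theorem integral_mem_of_rtCheck {e : RExpr} {c a h : ℚ} {n S K k : ℕ} {lo hi : ℚ}
    (hchk : rtCheck e c a h n S K k lo hi = true) :
    (lo : ℝ) ≤ ∫ x, Real.exp (-(c : ℝ) * x ^ 2) * evalR e x ∧
      ∫ x, Real.exp (-(c : ℝ) * x ^ 2) * evalR e x ≤ (hi : ℝ) := by
  unfold rtCheck at hchk
  simp only [Bool.and_eq_true, decide_eq_true_eq] at hchk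
  obtain ⟨⟨⟨⟨⟨hc, ha⟩, hh⟩, hok⟩, hS⟩, hrest⟩ := hchk
  split at hrest
  · simp at hrest
  · rename_i D hD
    simp only [Bool.and_eq_true, decide_eq_true_eq] at hrest
    obtain ⟨h1, h2⟩ := hrest
    unfold rtData at hD
    split at hD
    · rename_i U piI hU hpiEq
      split at hD
      · rename_i T E₁ E₂ hT hE₁ hE₂
        simp only [Option.some.injEq] at hD
        subst hD
        dsimp only at h1 h2
        set I : ℝ := ∫ x, wR c e x with hIdef
        set V : ℝ := (h : ℝ) * truncSum c e h n with hVdef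
        set ε : ℝ := 2 * (U * Real.exp (c * a ^ 2) * Real.sqrt (π / c)) /
            (Real.exp (2 * π * a / h) - 1) +
          2 * ((h : ℝ) * U) * Real.exp (-(c : ℝ) * (((n + 1 : ℕ) : ℝ) * h) ^ 2) /
            (1 - Real.exp (-(2 * c * h ^ 2 * (n + 1 : ℕ)))) with hε
        have hSr : (0 : ℝ) < S := by exact_mod_cast hS
        have hpi := MI.mem_pi S hpiEq
        have hV : MI.mem S V (MI.mul S (ofRat S h) T) :=
          MI.mem_mul hS (mem_ofRat S h) (mem_rtSum hS hpi c e h n hT)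
        have herr : MI.mem S ε (E₁.add E₂) :=
          MI.mem_add (mem_discErrMI hS hpi hE₁) (mem_truncErrMI hS hE₂)
        have habs := abs_truncSum_sub_integral_le hc ha hh hok hU n
        rw [← hVdef, ← hIdef, ← hε, abs_le] at habs
        obtain ⟨hA1, hA2⟩ := hV
        obtain ⟨hB1, hB2⟩ := herr
        have h1r : (lo.num : ℝ) * S ≤
            (((MI.mul S (ofRat S h) T).lo : ℝ) - (E₁.add E₂).hi) * lo.den := by
          exact_mod_cast h1
        have h2r : (((MI.mul S (ofRat S h) T).hi : ℝ) + (E₁.add E₂).hi) * hi.den ≤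
            hi.num * S := by
          exact_mod_cast h2
        have hdlo : (0 : ℝ) < lo.den := by exact_mod_cast lo.den_pos
        have hdhi : (0 : ℝ) < hi.den := by exact_mod_cast hi.den_pos
        change (lo : ℝ) ≤ I ∧ I ≤ (hi : ℝ)
        constructor
        · have keylo : (lo.num : ℝ) * S ≤ I * lo.den * S := by
            calc (lo.num : ℝ) * S
                ≤ (((MI.mul S (ofRat S h) T).lo : ℝ) - (E₁.add E₂).hi) * lo.den := h1r
              _ ≤ (V - ε) * S * lo.den := by
                  apply mul_le_mul_of_nonneg_right _ hdlo.le
                  linarith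
              _ ≤ I * S * lo.den := by
                  apply mul_le_mul_of_nonneg_right _ hdlo.le
                  apply mul_le_mul_of_nonneg_right _ hSr.le
                  linarith
              _ = I * lo.den * S := by ring
          have keylo' : (lo.num : ℝ) ≤ I * lo.den := le_of_mul_le_mul_right keylo hSr
          rw [Rat.cast_def, div_le_iff₀ hdlo]
          exact keylo'
        · have keyhi : I * hi.den * S ≤ (hi.num : ℝ) * S := by
            calc I * hi.den * S = I * S * hi.den := by ring
              _ ≤ (V + ε) * S * hi.den := by
                  apply mul_le_mul_of_nonneg_right _ hdhi.le
                  apply mul_le_mul_of_nonneg_right _ hSr.le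
                  linarith
              _ ≤ (((MI.mul S (ofRat S h) T).hi : ℝ) + (E₁.add E₂).hi) * hi.den := by
                  apply mul_le_mul_of_nonneg_right _ hdhi.le
                  linarith
              _ ≤ hi.num * S := h2r
          have keyhi' : I * hi.den ≤ (hi.num : ℝ) := le_of_mul_le_mul_right keyhi hSr
          rw [Rat.cast_def, le_div_iff₀ hdhi]
          exact keyhi'
      · simp at hD
    · simp at hD

end RealLineTrapezoid

end Literature.Analysis.ValidatedNumerics
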